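import Literature.Probability.RandomPlanarGeometry.YangBaxterSAWHexDictionaryWinding
import HarnessLib

/-!
# The hexagonal dictionary: the hole-root defect at `θ = π/3` as a sum over wound walks

Source: H. Duminil-Copin, S. Smirnov, *The connective constant of the honeycomb lattice equals `√(2+√2)`*,
Ann. of Math. 175 (2012), Lemma 1 and its proof [DuminilCopinSmirnov2012]; A. Glazman, I. Manolescu,
*Self-avoiding walk on `ℤ²` with Yang–Baxter weights: universality of critical fugacity and 2-point function*
(2019), §1 (θ = π/3, Fig. 2) and Lemma 2.1, eq. (2.2) [GlazmanManolescu2019]; A. Glazman, *Connective constant for a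
weighted self-avoiding walk on `ℤ²`* (2015), Lemma 3.1 [Glazman2015WeightedSAW].

This file closes the bookkeeping of the lane's hexagonal dictionary (`YangBaxterSAWHexDictionary`, §12–§15, and its winding
side `YangBaxterSAWHexDictionaryWinding`, editions 1–6). At `θ = π/3` the Yang–Baxter vertex functional `VF(f)` of a
hole-rooted rhombus domain is, times `2ω − 1`, the sum over the two triangles `T` of `f` of Duminil-Copin–Smirnov's vertex
relation at `T`, whose only surviving terms are the ENCIRCLING ones: loop-class mid-edge walks at `T` winding about the root
face. The winding file proved that these are in bijection with the WOUND Yang–Baxter walks of class `B2a` at `f` of non-zero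
weight (side-ending ones ↔ non-`θ`-corner arcs, editions 1–2; diagonal-ending ones ↔ `θ`-corner arcs, edition 6). Here the
two encircling sums are rewritten, by `Finset.sum_image` along these bijections, as sums over wound walks, giving the
PER-WALK expansion of the defect

`(2ω − 1) · VF_{π/3}(Dl; 0; f) = Σ_{σ ∈ {W,E}} ( Σ_{ω wound, non-corner, into f.hv σ} (2ω − 1)·crCoef(π/3, ω.1)·paraWeight ω.2`
`                                              + Σ_{ω wound, θ-corner in f.hv σ} edir (f.hv σ) (f.hv ω.1) · pwt (hvWalk ω ++ [f.hv σ]) )`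

with the corner terms in closed form `± (1 + ω) · x_c · λ^{∓1} · paraWeight ω` (`…_closed`)

(`vertexFunctional_pi_div_three_origin_eq_sum_wound`), companion to Glazman–Manolescu's per-pair expansion
`vertexFunctional_printed_eq_wound_sum` of `YangBaxterSAWUnwoundPlaquette` (valid on all of `[π/3, 2π/3]`).

Edition 2 (§4) makes the identification GROUP BY GROUP: for every class-`B2a` walk `ω` at `f` of non-zero `π/3`-weight,
`(2ω − 1)·G_{π/3}(ω)` — Glazman–Manolescu's half-group (the walk plus its one-arc extension through `f`) — IS Duminil-Copin–Smirnov's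
single surviving honeycomb term of `ω` (side-ending for a non-`θ`-corner arc, diagonal-ending for a `θ`-corner arc: the extension
either weighs nothing, `w₂(π/3) = 0`, or is absorbed by DCS's triplet relation at the return triangle), so that GM's four-member
group of `{ω, rev ω}` is DCS's pair, the signed class term at the hexagonal angle is that pair over `2i(2ω − 1)`, and the pair of an
unwound walk cancels:

`(2ω − 1) · (G_{π/3} ω + G_{π/3} (rev ω)) = dcsTerm ω + dcsTerm (rev ω)`   (`two_mul_omg_sub_one_mul_G_add_G_rev_pi_div_three_eq`).

Edition 3 (§5) is the counting form: the bijections as set identities, and the census count `C(f)` of encircling loop-class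
walks through the two triangles of `f` as the number of wound class-`B2a` walks at `f` of non-zero `π/3`-weight
(`card_encircling_add_card_encircling_eq_card_wound`), zero iff every wound returning walk at `f` has weight zero.

Edition 4 (§6) treats the other class: for a class-`A` walk (first hit of `∂f` = its end) of non-zero weight, `2ω − 1` times
Glazman–Manolescu's FIRST group (the walk and its three one-arc extensions) is the sum of Duminil-Copin–Smirnov's two TRIPLETS at the two
triangles of `f` (`two_mul_omg_sub_one_mul_groupOne_pi_div_three_eq`), each of which vanishes: GM's two local relations at `π/3` are DCS's
triplet and pair relations — the proof-level dictionary is complete.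

## Contents (all in `Literature.Probability.RandomPlanarGeometry.SAW.YangBaxter.ΩG` unless stated)
* `eq_of_hvWalk_eq_of_origin` — injectivity of `ω ↦ ω.2.hvWalk` on nontrivial returning walks (arrival side included);
* `finalDart_hvWalk_append`, `pwt_hvWalk_append` — the final half-edge and the weight of a pushed honeycomb walk;
* `exists_finalDart_fst_eq_hv_of_not_isSome` — a loop-class walk not ending across a rhombus side ends across the diagonal;
* ★ `sum_encircling_side_eq` — the side-ending encircling sum at `f.hv σ` = the sum of the encircling terms of the wound
  non-corner walks returning into `f.hv σ`;
* ★ `sum_encircling_diag_eq` — the diagonal-ending encircling sum at `f.hv σ` = the sum of the pushed terms of the wound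
  `θ`-corner walks whose corner arc lies in `f.hv σ`;
* ★ `cornerTerm_eq`, `sum_encircling_diag_eq_closed` — the pushed (corner) term in closed form `± (1 + ω)·x_c·λ^{∓1}·paraWeight ω.2`
  (lattice constants `edir_hv_hv_of_tri_ne`, `turn_hvAcross_hv_hv` of §0, in `…SAW.YangBaxter`);
* ★★ `vertexFunctional_pi_div_three_origin_eq_sum_wound` (and `…_closed`) — the defect as a sum over wound walks.
* §4 (edition 2), GROUP = PAIR: `phase_int_mul_pi_div_three` (phases of multiples of `π/3` are powers of `λ`),
  `triplet_identity_rotated_S/E` (DCS's triplet identity in the two rotated forms used), `pairWeight_pi_div_three_eq_zero`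
  (the two-arc extension weighs nothing unless both arcs are `θ`-corners), ★ `triangle_relation_pi_div_three` (one identity of
  lattice constants per ordered class `(z₀, z₁, z₂, z₃)`, 24 classes), ★★ `two_mul_omg_sub_one_mul_bracket_pi_div_three` (GM's bracket
  at `π/3` is a DCS pair), `weight_rev_pi_div_three_ne_zero`, `dcsTerm_pi_div_three_eq`, `T₃_pi_div_three_eq_zero_of_ne_corner`,
  ★★★ `two_mul_omg_sub_one_mul_G_pi_div_three_eq` (HALF-GROUP = SURVIVING TERM), ★★★ `two_mul_omg_sub_one_mul_G_add_G_rev_pi_div_three_eq`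
  (GROUP = PAIR), ★★ `two_I_mul_classTerm_pi_div_three_eq` / `dcsPair_pi_div_three_eq_backBracket` (the signed class term at the
  hexagonal angle), ★★ `dcsPair_pi_div_three_eq_zero_of_unwound` (the pair of an unwound walk cancels — DCS's pair cancellation from
  GM's `groupTwo_gen`).
* §5 (edition 3), COUNTING: `filter_encircling_side_eq_image`, `filter_encircling_diag_eq_image` (the bijections as set
  identities), ★ `card_encircling_hv_eq` (the count at one triangle), ★★ `card_encircling_add_card_encircling_eq_card_wound`
  (`C(f)` = the number of wound returning walks of non-zero weight), ★ `encircling_eq_empty_iff_forall_wound_weight_eq_zero`.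
* §6 (edition 4), GROUP ONE = TWO TRIPLETS: `hvWalk_extA`, `weight_extA_pi_div_three_ne_zero`, ★ `two_mul_omg_sub_one_mul_g_extA_pi_div_three`
  (the term of an extension is DCS's term of its honeycomb walk), `two_mul_omg_sub_one_mul_g_pi_div_three`, `HV.pwt_append_pair`,
  `tripletConst_pi_div_three_diag` (the triplet identity in the rhombus frame), ★★ `two_mul_omg_sub_one_mul_groupOne_pi_div_three_eq`,
  `g_add_sum_g_extA_pi_div_three_eq_zero`, ★ `tripletDiag_pi_div_three_eq_zero`, ★ `tripletSide_pi_div_three_eq_zero`.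

The wound/weight conditions are spelled out inline (`∃ (hr : RootedFace …) (h : ω.IsB2a), arcKind … ∧ ω.AJ hr h (root) ≠ 0`,
`ω.2.weight (π/3) ≠ 0`); the surviving term `dcsTerm ω` of §4 is likewise the inline `if arcKind z₀ z₁ = corner then (pushed term)
else (side term)`; no new definitions. Editions: ed.1 = §0–§3; ed.2 = ed.1 verbatim ⊕ §4 (appended); ed.3 = ed.2 verbatim ⊕ §5 (appended); ed.4 = ed.3 verbatim ⊕ §6 (appended).
-/

noncomputable section

open Real

namespace Literature.Probability.RandomPlanarGeometry.SAW

namespace YangBaxter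

open MidEdge
open Literature.Barriers.CriticalPhenomena.PlaquetteWalk
open Literature.Barriers.CriticalPhenomena (PlaquetteWalk.dom)

section SumForm

/-! ## §0. Two lattice constants: across the short diagonal -/

/-- **The direction across the short diagonal of a rhombus**, from one triangle centre-class vertex to the other, in `ℤ[ω]`:
`1 + ω` from the `W/N`-type triangle (`tri = false`) to the `E/S`-type one, `−(1 + ω)` back. [cite: DuminilCopinSmirnov2012, §1 (the hexagonal lattice
embedded with mid-edges)] [cite: GlazmanManolescu2019, §1 (Fig. 2: the rhombic tiling over the hexagonal lattice)] -/
theorem edir_hv_hv_of_tri_ne (f : Face) {σ s : Side} (h : σ.tri ≠ s.tri) :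
    HV.edir (f.hv σ) (f.hv s) = (if σ.tri then -1 else 1) * (1 + HV.omg) := by
  obtain ⟨k, j⟩ := f
  cases s <;> cases σ <;> simp [Side.tri] at h <;>
    simp only [HV.edir, HV.pos, Face.hv, Side.tri, HV.emb, Prod.mk_sub_mk, if_true, if_false, Bool.false_eq_true] <;>
    push_cast <;> ring

/-- **The turn into the short diagonal.** Arriving in the triangle `f.hv s` across the side `s` (from `f.hvAcross s`) and leaving
across the short diagonal (to the other triangle `f.hv σ`) is a turn by `−π/3` for `s ∈ {W, E}` and by `+π/3` for `s ∈ {S, N}`.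
[cite: DuminilCopinSmirnov2012, §2 (the winding of a walk on the hexagonal lattice, by ±π/3 per vertex)] -/
theorem turn_hvAcross_hv_hv (f : Face) {s σ : Side} (h : σ.tri ≠ s.tri) :
    HV.turn (f.hvAcross s) (f.hv s) (f.hv σ) = if s = .W ∨ s = .E then -1 else 1 := by
  obtain ⟨k, j⟩ := f
  cases s <;> cases σ <;> simp [Side.tri] at h <;>
    simp only [HV.turn, HV.pos, Face.hv, Face.hvAcross, Side.tri] <;> norm_num <;>
    simp only [HV.cross] <;> ring_nf <;> first | omega | rfl

/-! ## §1. Injectivity, pushed walks, side- versus diagonal-ending -/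

namespace ΩG

open YBWalk HV

open private fh_lt from Literature.Probability.RandomPlanarGeometry.YangBaxterSAWGeneralDomain

variable {Dl : List Face} {f : Face}

/-- **Injectivity of the dictionary on returning walks.** Two nontrivial Yang–Baxter walks from the origin to sides of the
same rhombus `f` with the same honeycomb walk are equal — as elements of `ΩG`, i.e. INCLUDING the arrival side: the final
half-edge of the honeycomb walk crosses the final mid-edge (the dictionary's `edgeOf_finalDart_hvWalk_of_origin'`), and the
mid-edge sequence is read off the honeycomb walk (`YBWalk.eq_of_hvWalk_eq`).
[cite: GlazmanManolescu2019, §1 (Fig. 2: a walk meets a rhombus in «either void or one arc»)] [cite: DuminilCopinSmirnov2012, §1 (walks between mid-edges)] -/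
theorem eq_of_hvWalk_eq_of_origin {D : Set Face} (hD : ((-1 : ℤ), (0 : ℤ)) ∉ D) {ω ω' : ΩG D origin f}
    (hn : 0 < ω.2.arcs.length) (hn' : 0 < ω'.2.arcs.length) (h : ω.2.hvWalk = ω'.2.hvWalk) : ω = ω' := by
  obtain ⟨s, γ⟩ := ω
  obtain ⟨s', γ'⟩ := ω'
  have e := γ.edgeOf_finalDart_hvWalk_of_origin' hD
  have e' := γ'.edgeOf_finalDart_hvWalk_of_origin' hD
  simp only at h
  rw [h, e'] at e
  have hs : s' = s := Face.side_injective f (Option.some_injective _ e)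
  subst hs
  simp only at hn hn'
  have := YBWalk.eq_of_hvWalk_eq hn hn' h
  subst this
  rfl

/-- The final half-edge of the honeycomb walk of a returning walk PUSHED one step to a vertex `T`: from the return
triangle `f.hv s` to `T` (the walk arrives at the side `f.side s` from outside `f`, `hch`). [cite: DuminilCopinSmirnov2012, §1 (walks between mid-edges)] -/
theorem finalDart_hvWalk_append {D : Set Face} (hD : ((-1 : ℤ), (0 : ℤ)) ∉ D) {s : Side}
    (γ : YBWalk D origin (f.side s)) (hn : 0 < γ.arcs.length) (hch : γ.fc (γ.arcs.length - 1) ≠ f) (T : HV) :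
    HV.finalDart (γ.hvWalk ++ [T]) = (f.hv s, T) := by
  rw [γ.hvWalk_of_origin hD hn, acrossOut_last_eq_hv rfl hn hch, List.cons_append,
    HV.finalDart_cons_append (by simp) T]
  simp

/-- **The weight of a pushed walk.** Pushing the honeycomb walk of a nontrivial walk from the origin one step to a vertex `T`
multiplies Duminil-Copin–Smirnov's weight `pwt = x_c^{#steps} · λ^{turning}` by `x_c · λ^{turn (lastTri, last vertex, T)}`.
[cite: DuminilCopinSmirnov2012, §2 (the weight `x^{ℓ} e^{-iσ W}` of a walk)] -/
theorem pwt_hvWalk_append {D : Set Face} {z : MidEdge} (hD : ((-1 : ℤ), (0 : ℤ)) ∉ D) (γ : YBWalk D origin z)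
    (hn : 0 < γ.arcs.length) (T : HV) :
    HV.pwt (γ.hvWalk ++ [T]) =
      HV.pwt γ.hvWalk * (hexCriticalFugacity : ℂ) * HV.lam ^ HV.turn γ.lastTri (γ.acrossOut (γ.arcs.length - 1)) T := by
  have hne : γ.hvInner ≠ [] := hvUpTo_ne_nil hn
  rw [γ.hvWalk_of_origin hD hn]
  have e1 : HV.wOut :: (γ.hvInner ++ [γ.acrossOut (γ.arcs.length - 1)]) ++ [T] =
      (HV.wOut :: γ.hvInner) ++ [γ.acrossOut (γ.arcs.length - 1), T] := by simp
  have e2 : HV.wOut :: (γ.hvInner ++ [γ.acrossOut (γ.arcs.length - 1)]) =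
      (HV.wOut :: γ.hvInner) ++ [γ.acrossOut (γ.arcs.length - 1)] := by simp
  have hlast : (HV.wOut :: γ.hvInner).getLast (List.cons_ne_nil _ _) = γ.lastTri := by
    rw [List.getLast_cons hne]; exact γ.getLast_hvUpTo_length hn
  have hm : HV.mwLen ((HV.wOut :: γ.hvInner) ++ [γ.acrossOut (γ.arcs.length - 1), T]) =
      HV.mwLen ((HV.wOut :: γ.hvInner) ++ [γ.acrossOut (γ.arcs.length - 1)]) + 1 := by
    simp only [HV.mwLen, List.length_append, List.length_cons, List.length_nil]
    omega
  rw [e1, HV.pwt, HV.pwt, HV.pturn_concat_turn _ (List.cons_ne_nil _ _), hlast, ← e2, hm, pow_succ,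
    zpow_add₀ HV.lam_ne_zero]
  rw [e2]
  ring

/-- **Side-ending versus diagonal-ending.** A loop-class mid-edge walk of Duminil-Copin–Smirnov at a triangle `f.hv σ` whose
final half-edge does NOT cross a rhombus side arrives across the short diagonal of `f`, i.e. from the other triangle
`f.hv σ'`, `σ'.tri ≠ σ.tri` (the three honeycomb neighbours of a triangle: two across rhombus sides, one across the
diagonal — the dictionary's `adj_hv_cases`). [cite: GlazmanManolescu2019, §1 (Fig. 2)] [cite: DuminilCopinSmirnov2012, proof of Lemma 1 (the three classes of walks at `v`)] -/
theorem exists_finalDart_fst_eq_hv_of_not_isSome {V : Finset HV} {σ : Side} {P : List HV}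
    (hP : P ∈ clsLoop V (f.hv σ)) (hE : ¬ ((edgeOf (HV.finalDart P).1 (HV.finalDart P).2).isSome)) :
    ∃ σ' : Side, σ'.tri ≠ σ.tri ∧ (HV.finalDart P).1 = f.hv σ' := by
  rw [HV.clsLoop, Finset.mem_filter] at hP
  obtain ⟨hPm, hlast, hinner⟩ := hP
  have hPw := HV.mem_midWalks_iff.1 hPm
  obtain ⟨Q, hQ⟩ := hPw.exists_eq_cons
  obtain ⟨l, u, hlu⟩ : ∃ l u, hvOrigin :: Q = l ++ [u] := by
    rcases (hvOrigin :: Q).eq_nil_or_concat' with h0 | ⟨l, u, h0⟩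
    · simp at h0
    · exact ⟨l, u, h0⟩
  rw [hlu] at hQ
  have hl0 : l ≠ [] := by
    rintro rfl
    rw [hQ] at hinner
    simp [HV.inner] at hinner
  have hfd : HV.finalDart P = (l.getLast hl0, u) := by rw [hQ, HV.finalDart_cons_append hl0]
  have hu : u = f.hv σ := by rw [hfd] at hlast; exact hlast
  subst hu
  have hadj : hvGraph.Adj (l.getLast hl0) (f.hv σ) := by
    have hc := hPw.1
    rw [hQ, ← List.cons_append, List.isChain_append] at hc
    exact hc.2.2 _ (by rw [Option.mem_def, List.getLast?_eq_some_getLast (List.cons_ne_nil _ _), List.getLast_cons hl0])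
      _ (by simp)
  rcases adj_hv_cases hadj.symm with ⟨σ', hσ', he⟩ | ⟨t, ht, he⟩
  · exact ⟨σ', hσ', by rw [hfd, he]⟩
  · exfalso
    apply hE
    rw [hfd, he, show f.hv σ = f.hv t from Face.hv_eq_hv_iff.2 ⟨rfl, ht.symm⟩, edgeOf_hvAcross_hv]
    rfl

/-! ## §2. The two encircling sums as sums over wound walks -/

open scoped Classical in
/-- ★★★ **THE SIDE-ENDING ENCIRCLING SUM IS A SUM OVER WOUND WALKS (non-`θ`-corner arcs).** For a finite rhombus list `Dl`
not containing `(-1, 0)`, rooted at the origin, a rhombus `f` and a triangle `T = f.hv σ` of it: the part of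
Duminil-Copin–Smirnov's encircling sum at `T` (the loop-class walks at `T` winding about the root face, weighted by
`edir T (finalDart P).1 · pwt P` — the right-hand side of the lane's `sum_cv_eq_sum_encircling`) carried by the walks whose
final half-edge crosses a RHOMBUS SIDE equals the sum, over the Yang–Baxter walks `ω` from the origin of class `B2a` at `f`
returning into the triangle `T` (`ω.1.tri = σ.tri`) through a non-`θ`-corner first arc, of non-zero weight and WOUND
(`AJ ≠ 0`: the excursion polygon winds about the root), of the encircling terms `(2ω − 1) · crCoef (π/3) ω.1 · paraWeight ω.2`.
The bijection `ω ↦ ω.2.hvWalk` is the winding file's (editions 1–2: `hvWalk_mem_encircling_iff_AJ_root_ne_zero`,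
`exists_isB2a_of_mem_clsLoop`), injective by `eq_of_hvWalk_eq_of_origin`; the term is its `YBWalk.edir_mul_pwt_hvWalk_eq`.
[cite: DuminilCopinSmirnov2012, Lemma 1 and its proof (the encircling pairs)] [cite: GlazmanManolescu2019, Lemma 2.1, eq. (2.2)]
[cite: Glazman2015WeightedSAW, Lemma 3.1 (proof, pp. 6–7)] -/
theorem sum_encircling_side_eq (hD : ((-1 : ℤ), (0 : ℤ)) ∉ Dl) (f : Face) (σ : Side) :
    ∑ P ∈ ((clsLoop (triSet Dl.toFinset) (f.hv σ)).filter (fun P => HV.loopWnd (f.hv σ) P ≠ 0)).filter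
        (fun P => (edgeOf (HV.finalDart P).1 (HV.finalDart P).2).isSome),
      HV.edir (f.hv σ) (HV.finalDart P).1 * HV.pwt P =
    ∑ ω ∈ (Finset.univ : Finset (ΩG (PlaquetteWalk.dom Dl) origin f)).filter (fun ω =>
        (ω.1).tri = σ.tri ∧ ω.2.weight (fun _ => π / 3) ≠ 0 ∧
        ∃ (hr : RootedFace (PlaquetteWalk.dom Dl) origin f) (h : ω.IsB2a),
          arcKind ω.2.firstSideG (ω.z1 hr h) ≠ .corner ∧ ω.AJ hr h (toC (midPt origin)) ≠ 0),
      (2 * HV.omg - 1) * crCoef (π / 3) ω.1 * ω.2.paraWeight (fun _ => π / 3) := by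
  have hD' : ((-1 : ℤ), (0 : ℤ)) ∉ PlaquetteWalk.dom Dl := hD
  set B := (Finset.univ : Finset (ΩG (PlaquetteWalk.dom Dl) origin f)).filter (fun ω =>
        (ω.1).tri = σ.tri ∧ ω.2.weight (fun _ => π / 3) ≠ 0 ∧
        ∃ (hr : RootedFace (PlaquetteWalk.dom Dl) origin f) (h : ω.IsB2a),
          arcKind ω.2.firstSideG (ω.z1 hr h) ≠ .corner ∧ ω.AJ hr h (toC (midPt origin)) ≠ 0) with hB
  have hBmem : ∀ ω, ω ∈ B ↔ (ω.1).tri = σ.tri ∧ ω.2.weight (fun _ => π / 3) ≠ 0 ∧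
        ∃ (hr : RootedFace (PlaquetteWalk.dom Dl) origin f) (h : ω.IsB2a),
          arcKind ω.2.firstSideG (ω.z1 hr h) ≠ .corner ∧ ω.AJ hr h (toC (midPt origin)) ≠ 0 := fun ω => by
    rw [hB, Finset.mem_filter]; simp only [Finset.mem_univ, true_and]
  have hpos : ∀ ω ∈ B, 0 < ω.2.arcs.length := fun ω hω => by
    obtain ⟨-, -, hr, h, -⟩ := (hBmem ω).1 hω
    have := fh_lt ω h; omega
  -- the image
  have himg : ((clsLoop (triSet Dl.toFinset) (f.hv σ)).filter (fun P => HV.loopWnd (f.hv σ) P ≠ 0)).filter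
        (fun P => (edgeOf (HV.finalDart P).1 (HV.finalDart P).2).isSome) = B.image (fun ω => ω.2.hvWalk) := by
    ext P
    simp only [Finset.mem_filter, Finset.mem_image]
    constructor
    · rintro ⟨⟨hP, hwnd⟩, hE⟩
      obtain ⟨ω, hr, h, hωP, htri, hw, hκ, hiff⟩ := exists_isB2a_of_mem_clsLoop (f := f) hD hP hE
      exact ⟨ω, (hBmem ω).2 ⟨htri, hw, hr, h, hκ, hiff.1 hwnd⟩, hωP⟩
    · rintro ⟨ω, hω, rfl⟩
      obtain ⟨htri, hw, hr, h, hκ, hAJ⟩ := (hBmem ω).1 hω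
      have hT : f.hv ω.1 = f.hv σ := Face.hv_eq_hv_iff.2 ⟨rfl, htri⟩
      have hm := (hvWalk_mem_encircling_iff_AJ_root_ne_zero (hr := hr) hD h hκ hw).2 hAJ
      rw [Finset.mem_filter, hT] at hm
      refine ⟨hm, ?_⟩
      rw [ω.2.edgeOf_finalDart_hvWalk_of_origin' hD']
      rfl
  rw [himg, Finset.sum_image (fun ω hω ω' hω' e => eq_of_hvWalk_eq_of_origin hD' (hpos ω hω) (hpos ω' hω') e)]
  refine Finset.sum_congr rfl fun ω hω => ?_
  obtain ⟨htri, hw, hr, h, hκ, hAJ⟩ := (hBmem ω).1 hω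
  have hT : f.hv ω.1 = f.hv σ := Face.hv_eq_hv_iff.2 ⟨rfl, htri⟩
  rw [← hT]
  exact YBWalk.edir_mul_pwt_hvWalk_eq hD' ω.2 (hpos ω hω) (fc_ne_of_isB2a hr h) hw

open scoped Classical in
/-- ★★★ **THE DIAGONAL-ENDING ENCIRCLING SUM IS A SUM OVER WOUND `θ`-CORNER WALKS.** Same setting; the part of the encircling
sum at `T = f.hv σ` carried by the walks whose final half-edge crosses the SHORT DIAGONAL of `f` equals the sum, over the
Yang–Baxter walks `ω` from the origin of class `B2a` at `f` whose first arc in `f` is a `θ`-corner arc inside the triangle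
`T` (`f.hv ω.2.firstSideG = T`), of non-zero weight and wound, of the terms `edir T (f.hv ω.1) · pwt (ω.2.hvWalk ++ [T])` of
their pushed honeycomb walks (which return into the other triangle `f.hv ω.1` and step across the diagonal into `T`). The
bijection `ω ↦ ω.2.hvWalk ++ [T]` is the winding file's edition 6 (`hvWalk_append_mem_clsLoop_of_corner`,
`exists_isB2a_corner_of_mem_clsLoop_diag`). [cite: DuminilCopinSmirnov2012, Lemma 1 and its proof (the encircling pairs)]
[cite: GlazmanManolescu2019, Lemma 2.1, eq. (2.2) and §1 (Fig. 2)] [cite: Glazman2015WeightedSAW, Lemma 3.1 (proof, pp. 6–7)] -/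
theorem sum_encircling_diag_eq (hD : ((-1 : ℤ), (0 : ℤ)) ∉ Dl) (f : Face) (σ : Side) :
    ∑ P ∈ ((clsLoop (triSet Dl.toFinset) (f.hv σ)).filter (fun P => HV.loopWnd (f.hv σ) P ≠ 0)).filter
        (fun P => ¬ ((edgeOf (HV.finalDart P).1 (HV.finalDart P).2).isSome)),
      HV.edir (f.hv σ) (HV.finalDart P).1 * HV.pwt P =
    ∑ ω ∈ (Finset.univ : Finset (ΩG (PlaquetteWalk.dom Dl) origin f)).filter (fun ω =>
        f.hv ω.2.firstSideG = f.hv σ ∧ ω.2.weight (fun _ => π / 3) ≠ 0 ∧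
        ∃ (hr : RootedFace (PlaquetteWalk.dom Dl) origin f) (h : ω.IsB2a),
          arcKind ω.2.firstSideG (ω.z1 hr h) = .corner ∧ ω.AJ hr h (toC (midPt origin)) ≠ 0),
      HV.edir (f.hv σ) (f.hv ω.1) * HV.pwt (ω.2.hvWalk ++ [f.hv σ]) := by
  have hD' : ((-1 : ℤ), (0 : ℤ)) ∉ PlaquetteWalk.dom Dl := hD
  set B := (Finset.univ : Finset (ΩG (PlaquetteWalk.dom Dl) origin f)).filter (fun ω =>
        f.hv ω.2.firstSideG = f.hv σ ∧ ω.2.weight (fun _ => π / 3) ≠ 0 ∧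
        ∃ (hr : RootedFace (PlaquetteWalk.dom Dl) origin f) (h : ω.IsB2a),
          arcKind ω.2.firstSideG (ω.z1 hr h) = .corner ∧ ω.AJ hr h (toC (midPt origin)) ≠ 0) with hB
  have hBmem : ∀ ω, ω ∈ B ↔ f.hv ω.2.firstSideG = f.hv σ ∧ ω.2.weight (fun _ => π / 3) ≠ 0 ∧
        ∃ (hr : RootedFace (PlaquetteWalk.dom Dl) origin f) (h : ω.IsB2a),
          arcKind ω.2.firstSideG (ω.z1 hr h) = .corner ∧ ω.AJ hr h (toC (midPt origin)) ≠ 0 := fun ω => by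
    rw [hB, Finset.mem_filter]; simp only [Finset.mem_univ, true_and]
  have hpos : ∀ ω ∈ B, 0 < ω.2.arcs.length := fun ω hω => by
    obtain ⟨-, -, hr, h, -⟩ := (hBmem ω).1 hω
    have := fh_lt ω h; omega
  have hfd : ∀ ω ∈ B, HV.finalDart (ω.2.hvWalk ++ [f.hv σ]) = (f.hv ω.1, f.hv σ) := fun ω hω => by
    obtain ⟨-, -, hr, h, -⟩ := (hBmem ω).1 hω
    exact finalDart_hvWalk_append hD' ω.2 (hpos ω hω) (fc_ne_of_isB2a hr h) _
  have himg : ((clsLoop (triSet Dl.toFinset) (f.hv σ)).filter (fun P => HV.loopWnd (f.hv σ) P ≠ 0)).filter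
        (fun P => ¬ ((edgeOf (HV.finalDart P).1 (HV.finalDart P).2).isSome)) =
      B.image (fun ω => ω.2.hvWalk ++ [f.hv σ]) := by
    ext P
    simp only [Finset.mem_filter, Finset.mem_image]
    constructor
    · rintro ⟨⟨hP, hwnd⟩, hE⟩
      obtain ⟨σ', hσ', hfst⟩ := exists_finalDart_fst_eq_hv_of_not_isSome (f := f) hP hE
      obtain ⟨ω, hr, h, hωP, -, hw, hc, hT, hiff⟩ := exists_isB2a_corner_of_mem_clsLoop_diag hD hσ' hP hfst
      exact ⟨ω, (hBmem ω).2 ⟨hT, hw, hr, h, hc, hiff.1 hwnd⟩, hωP⟩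
    · rintro ⟨ω, hω, rfl⟩
      obtain ⟨hT, hw, hr, h, hc, hAJ⟩ := (hBmem ω).1 hω
      obtain ⟨-, hmem, hiff⟩ := hvWalk_append_mem_clsLoop_of_corner (hr := hr) hD h hc hw
      rw [hT] at hmem hiff
      refine ⟨⟨hmem, hiff.2 hAJ⟩, ?_⟩
      rw [hfd ω hω, edgeOf_hv_hv]
      exact Bool.false_ne_true
  rw [himg, Finset.sum_image (fun ω hω ω' hω' e => eq_of_hvWalk_eq_of_origin hD' (hpos ω hω) (hpos ω' hω')
    (List.append_cancel_right e))]
  refine Finset.sum_congr rfl fun ω hω => ?_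
  rw [hfd ω hω]

/-- ★ **The corner term in closed form.** For a wound-or-not class-`B2a` walk `ω` at `f` of non-zero weight and a triangle `f.hv σ` of `f`
other than its return triangle (`σ.tri ≠ ω.1.tri` — the triangle of a `θ`-corner first arc, `ΩG.tri_fst_ne_of_corner`): the pushed term
`edir (f.hv σ) (f.hv ω.1) · pwt (hvWalk ++ [f.hv σ])` equals `± (1 + ω) · x_c · λ^{∓1} · paraWeight ω.2` — the sign `−` iff `σ.tri`, the exponent
`−1` iff the return side `ω.1 ∈ {W, E}` (`edir_hv_hv_of_tri_ne`, `turn_hvAcross_hv_hv`, `pwt_hvWalk_append`, the dictionary's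
`paraWeight_pi_div_three` and `acrossOut_last_eq_hv`; the last triangle before the return is `f.hvAcross ω.1`).
[cite: DuminilCopinSmirnov2012, §2 (weights) and proof of Lemma 1] [cite: GlazmanManolescu2019, Lemma 2.1, eq. (2.2)] -/
theorem cornerTerm_eq {ω : ΩG (PlaquetteWalk.dom Dl) origin f} (hr : RootedFace (PlaquetteWalk.dom Dl) origin f)
    (hD : ((-1 : ℤ), (0 : ℤ)) ∉ Dl) (h : ω.IsB2a) (hw : ω.2.weight (fun _ => π / 3) ≠ 0) {σ : Side} (hσ : σ.tri ≠ (ω.1).tri) :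
    HV.edir (f.hv σ) (f.hv ω.1) * HV.pwt (ω.2.hvWalk ++ [f.hv σ]) =
      (if σ.tri then -1 else 1) * (1 + HV.omg) * (hexCriticalFugacity : ℂ) *
        HV.lam ^ (if ω.1 = .W ∨ ω.1 = .E then (-1 : ℤ) else 1) * ω.2.paraWeight (fun _ => π / 3) := by
  have hD' : ((-1 : ℤ), (0 : ℤ)) ∉ PlaquetteWalk.dom Dl := hD
  have hn : 0 < ω.2.arcs.length := by have := fh_lt ω h; omega
  have hch : ω.2.fc (ω.2.arcs.length - 1) ≠ f := fc_ne_of_isB2a hr h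
  have hlast : ω.2.lastTri = f.hvAcross ω.1 := by
    unfold YBWalk.lastTri
    exact (Face.hvAcross_eq_of_side_eq (YBWalk.side_sOut_lastG hn).symm (Ne.symm hch)).symm
  rw [edir_hv_hv_of_tri_ne f hσ, pwt_hvWalk_append hD' ω.2 hn, hlast, acrossOut_last_eq_hv rfl hn hch,
    turn_hvAcross_hv_hv f hσ, ← ω.2.paraWeight_pi_div_three hw]
  ring

open scoped Classical in
/-- ★★ **The diagonal-ending encircling sum in closed form**: the sum of `sum_encircling_diag_eq` with every pushed term evaluated by
`cornerTerm_eq` — `Σ_{ω wound, weight ≠ 0, θ-corner arc in f.hv σ} ± (1 + ω) · x_c · λ^{∓1} · paraWeight ω.2`.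
[cite: DuminilCopinSmirnov2012, Lemma 1 and its proof] [cite: GlazmanManolescu2019, Lemma 2.1, eq. (2.2)] [cite: Glazman2015WeightedSAW, Lemma 3.1 (proof, pp. 6–7)] -/
theorem sum_encircling_diag_eq_closed (hD : ((-1 : ℤ), (0 : ℤ)) ∉ Dl) (f : Face) (σ : Side) :
    ∑ P ∈ ((clsLoop (triSet Dl.toFinset) (f.hv σ)).filter (fun P => HV.loopWnd (f.hv σ) P ≠ 0)).filter
        (fun P => ¬ ((edgeOf (HV.finalDart P).1 (HV.finalDart P).2).isSome)),
      HV.edir (f.hv σ) (HV.finalDart P).1 * HV.pwt P =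
    ∑ ω ∈ (Finset.univ : Finset (ΩG (PlaquetteWalk.dom Dl) origin f)).filter (fun ω =>
        f.hv ω.2.firstSideG = f.hv σ ∧ ω.2.weight (fun _ => π / 3) ≠ 0 ∧
        ∃ (hr : RootedFace (PlaquetteWalk.dom Dl) origin f) (h : ω.IsB2a),
          arcKind ω.2.firstSideG (ω.z1 hr h) = .corner ∧ ω.AJ hr h (toC (midPt origin)) ≠ 0),
      (if σ.tri then -1 else 1) * (1 + HV.omg) * (hexCriticalFugacity : ℂ) *
        HV.lam ^ (if ω.1 = .W ∨ ω.1 = .E then (-1 : ℤ) else 1) * ω.2.paraWeight (fun _ => π / 3) := by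
  rw [sum_encircling_diag_eq hD f σ]
  refine Finset.sum_congr rfl fun ω hω => ?_
  rw [Finset.mem_filter] at hω
  obtain ⟨-, hT, hw, hr, h, hc, -⟩ := hω
  have hσ : σ.tri ≠ (ω.1).tri := by
    rw [← (Face.hv_eq_hv_iff.1 hT).2]
    exact (tri_fst_ne_of_corner (hr := hr) h hc).symm
  exact cornerTerm_eq hr hD h hw hσ

/-! ## §3. The defect as a sum over wound walks -/

open scoped Classical in
/-- ★★★ **THE HOLE-ROOT DEFECT AT `θ = π/3` AS A SUM OVER WOUND WALKS.** For every finite rhombus list `Dl` not containing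
`(-1, 0)`, rooted at the origin, and every rhombus `f ∈ Dl`: `(2ω − 1) · VF_{π/3}(Dl; 0; f)` — the Yang–Baxter vertex
functional of Glazman–Manolescu at `f`, times `2ω − 1 = i√3 ≠ 0` — is the sum over the two triangles `σ ∈ {W, E}` of `f` of
(i) the encircling terms `(2ω − 1) · crCoef (π/3) ω.1 · paraWeight ω.2` of the wound class-`B2a` walks of non-zero weight
returning into `f.hv σ` through a non-`θ`-corner arc, plus (ii) the pushed terms `edir (f.hv σ) (f.hv ω.1) · pwt (hvWalk ++ [f.hv σ])`
of the wound class-`B2a` walks of non-zero weight with a `θ`-corner first arc inside `f.hv σ`. This is Duminil-Copin–Smirnov's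
vertex relation summed over the two triangles (the dictionary's §12 `vertexFunctional_printed_pi_div_three_eq_sum_cv` and the
lane's `sum_cv_eq_sum_encircling`) with every surviving (encircling) honeycomb term renamed by the wound Yang–Baxter walk it comes
from (the two theorems above): a PER-WALK expansion of the defect, to be compared with Glazman–Manolescu's per-pair expansion
`vertexFunctional_printed_eq_wound_sum` (valid on all of `[π/3, 2π/3]`). In particular the defect vanishes as soon as every
wound walk at `f` has zero weight. [cite: DuminilCopinSmirnov2012, Lemma 1 and its proof] [cite: GlazmanManolescu2019, §1 (θ = π/3),
Lemma 2.1 and eq. (2.2)] [cite: Glazman2015WeightedSAW, Lemma 3.1 (proof, pp. 6–7)] -/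
theorem vertexFunctional_pi_div_three_origin_eq_sum_wound (hD : ((-1 : ℤ), (0 : ℤ)) ∉ Dl) (hf : f ∈ Dl) :
    (2 * HV.omg - 1) * vertexFunctional (printedWeights (π / 3)) tFiveEighths (ybCoeff (π / 3)) Dl origin f =
      ∑ σ ∈ ({Side.W, Side.E} : Finset Side),
        ((∑ ω ∈ (Finset.univ : Finset (ΩG (PlaquetteWalk.dom Dl) origin f)).filter (fun ω =>
            (ω.1).tri = σ.tri ∧ ω.2.weight (fun _ => π / 3) ≠ 0 ∧
            ∃ (hr : RootedFace (PlaquetteWalk.dom Dl) origin f) (h : ω.IsB2a),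
              arcKind ω.2.firstSideG (ω.z1 hr h) ≠ .corner ∧ ω.AJ hr h (toC (midPt origin)) ≠ 0),
          (2 * HV.omg - 1) * crCoef (π / 3) ω.1 * ω.2.paraWeight (fun _ => π / 3)) +
        (∑ ω ∈ (Finset.univ : Finset (ΩG (PlaquetteWalk.dom Dl) origin f)).filter (fun ω =>
            f.hv ω.2.firstSideG = f.hv σ ∧ ω.2.weight (fun _ => π / 3) ≠ 0 ∧
            ∃ (hr : RootedFace (PlaquetteWalk.dom Dl) origin f) (h : ω.IsB2a),
              arcKind ω.2.firstSideG (ω.z1 hr h) = .corner ∧ ω.AJ hr h (toC (midPt origin)) ≠ 0),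
          HV.edir (f.hv σ) (f.hv ω.1) * HV.pwt (ω.2.hvWalk ++ [f.hv σ]))) := by
  have hDF : ((-1 : ℤ), (0 : ℤ)) ∉ Dl.toFinset := fun e => hD (List.mem_toFinset.1 e)
  have hwV : HV.wOut ∉ triSet Dl.toFinset := wOut_not_mem_triSet hDF
  have hfF : f ∈ Dl.toFinset := List.mem_toFinset.2 hf
  have key : ∀ σ : Side, ∑ P ∈ HV.midWalks (triSet Dl.toFinset), HV.cv (f.hv σ) P =
      (∑ ω ∈ (Finset.univ : Finset (ΩG (PlaquetteWalk.dom Dl) origin f)).filter (fun ω =>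
            (ω.1).tri = σ.tri ∧ ω.2.weight (fun _ => π / 3) ≠ 0 ∧
            ∃ (hr : RootedFace (PlaquetteWalk.dom Dl) origin f) (h : ω.IsB2a),
              arcKind ω.2.firstSideG (ω.z1 hr h) ≠ .corner ∧ ω.AJ hr h (toC (midPt origin)) ≠ 0),
          (2 * HV.omg - 1) * crCoef (π / 3) ω.1 * ω.2.paraWeight (fun _ => π / 3)) +
        (∑ ω ∈ (Finset.univ : Finset (ΩG (PlaquetteWalk.dom Dl) origin f)).filter (fun ω =>
            f.hv ω.2.firstSideG = f.hv σ ∧ ω.2.weight (fun _ => π / 3) ≠ 0 ∧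
            ∃ (hr : RootedFace (PlaquetteWalk.dom Dl) origin f) (h : ω.IsB2a),
              arcKind ω.2.firstSideG (ω.z1 hr h) = .corner ∧ ω.AJ hr h (toC (midPt origin)) ≠ 0),
          HV.edir (f.hv σ) (f.hv ω.1) * HV.pwt (ω.2.hvWalk ++ [f.hv σ])) := fun σ => by
    rw [HV.sum_cv_eq_sum_encircling hwV (hv_mem_triSet hfF σ),
      ← Finset.sum_filter_add_sum_filter_not _ (fun P => ((edgeOf (HV.finalDart P).1 (HV.finalDart P).2).isSome)),
      sum_encircling_side_eq hD f σ, sum_encircling_diag_eq hD f σ]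
  rw [vertexFunctional_printed_pi_div_three_eq_sum_cv Dl hD f, Finset.sum_add_distrib, key, key,
    Finset.sum_pair (by decide)]

open scoped Classical in
/-- ★★★ **THE DEFECT AS A SUM OVER WOUND WALKS — CLOSED FORM**: the same identity with every term an explicit lattice constant times
the Yang–Baxter parafermionic weight of the wound walk: `(2ω − 1)·crCoef (π/3) ω.1 · paraWeight ω.2` for a non-`θ`-corner return into
`f.hv σ`, and `± (1 + ω) · x_c · λ^{∓1} · paraWeight ω.2` for a `θ`-corner arc in `f.hv σ` (`−` iff `σ.tri`; exponent `−1` iff the return side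
`ω.1 ∈ {W, E}`). So at `θ = π/3` the Yang–Baxter defect of a hole root at `f` is an explicit `ℤ[ω, x_c, λ^{±1}]`-linear combination of the
weights of the WOUND class-`B2a` walks at `f`, vanishing when they all have zero weight. [cite: DuminilCopinSmirnov2012, Lemma 1 and its proof]
[cite: GlazmanManolescu2019, §1 (θ = π/3), Lemma 2.1 and eq. (2.2)] [cite: Glazman2015WeightedSAW, Lemma 3.1 (proof, pp. 6–7)] -/
theorem vertexFunctional_pi_div_three_origin_eq_sum_wound_closed (hD : ((-1 : ℤ), (0 : ℤ)) ∉ Dl) (hf : f ∈ Dl) :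
    (2 * HV.omg - 1) * vertexFunctional (printedWeights (π / 3)) tFiveEighths (ybCoeff (π / 3)) Dl origin f =
      ∑ σ ∈ ({Side.W, Side.E} : Finset Side),
        ((∑ ω ∈ (Finset.univ : Finset (ΩG (PlaquetteWalk.dom Dl) origin f)).filter (fun ω =>
            (ω.1).tri = σ.tri ∧ ω.2.weight (fun _ => π / 3) ≠ 0 ∧
            ∃ (hr : RootedFace (PlaquetteWalk.dom Dl) origin f) (h : ω.IsB2a),
              arcKind ω.2.firstSideG (ω.z1 hr h) ≠ .corner ∧ ω.AJ hr h (toC (midPt origin)) ≠ 0),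
          (2 * HV.omg - 1) * crCoef (π / 3) ω.1 * ω.2.paraWeight (fun _ => π / 3)) +
        (∑ ω ∈ (Finset.univ : Finset (ΩG (PlaquetteWalk.dom Dl) origin f)).filter (fun ω =>
            f.hv ω.2.firstSideG = f.hv σ ∧ ω.2.weight (fun _ => π / 3) ≠ 0 ∧
            ∃ (hr : RootedFace (PlaquetteWalk.dom Dl) origin f) (h : ω.IsB2a),
              arcKind ω.2.firstSideG (ω.z1 hr h) = .corner ∧ ω.AJ hr h (toC (midPt origin)) ≠ 0),
          (if σ.tri then -1 else 1) * (1 + HV.omg) * (hexCriticalFugacity : ℂ) *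
            HV.lam ^ (if ω.1 = .W ∨ ω.1 = .E then (-1 : ℤ) else 1) * ω.2.paraWeight (fun _ => π / 3))) := by
  rw [vertexFunctional_pi_div_three_origin_eq_sum_wound hD hf]
  refine Finset.sum_congr rfl fun σ _ => ?_
  rw [← sum_encircling_diag_eq hD f σ, sum_encircling_diag_eq_closed hD f σ]

end ΩG

end SumForm

/-! ## §4. Group = pair (edition 2): at `θ = π/3` Glazman–Manolescu's group of a returning walk IS
Duminil-Copin–Smirnov's pair of surviving honeycomb terms — the dictionary term by term

§3 identified the two expansions of the hole-root defect at `θ = π/3` only AFTER summation. Here the identification is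
made GROUP BY GROUP. Glazman–Manolescu (after Glazman, Lemma 3.1) prove Lemma 2.1 by grouping the walks of class `B2` at
the rhombus `f`: the group of a class-`B2a` walk `ω` (first side `z₀`, exit `z₁`, return `z₂ = ω.1`, fourth side `z₃`)
consists of `ω`, its reversed companion `rev ω` and their one-arc extensions through `f`, and sums to
`extWeight · phase(WP) · bracket(θ; z₀, z₁, z₂, z₃; WE)` (`ΩG.G_add_G_rev_eq_bracket`, `G ω = g ω + T₃ ω` the half-group
of `ω`). Duminil-Copin–Smirnov prove their Lemma 1 by PAIRS (walks through all three mid-edges of a vertex) and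
TRIPLETS. At `π/3`, for a returning walk of non-zero weight:
* if the arc `z₀ → z₁` is NOT a `θ`-corner, the extension `ext₃ ω` carries two `(π − θ)`-corner arcs (`w₂(π/3) = 0`) or
  would be the forbidden straight crossing, so `T₃ ω = 0` and `(2ω − 1)·G ω = (2ω − 1)·g ω` is the SIDE-ending honeycomb
  term of `ω` at its return triangle (`ΩG.edir_mul_pwt_hvWalk_eq` of the winding file);
* if it IS a `θ`-corner, the honeycomb walk of `ω` arrives at the return triangle `T' = f.hv z₂` without having visited it,
  and Duminil-Copin–Smirnov's TRIPLET relation at `T'` (`1 + x_c(ω²λ⁻¹ − ωλ) = 0`) trades `ω` and `ext₃ ω` for minus the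
  walk pushed across the short diagonal; read at the other triangle `T = f.hv z₀` (the diagonal's midpoint is the
  midpoint of `TT'`) this is the DIAGONAL-ending term `cornerTerm` of §2: `(2ω − 1)·G ω = cornerTerm ω`.
Hence ★★★ `(2ω − 1)·G_{π/3} ω` = the single surviving honeycomb term of `ω`
(`two_mul_omg_sub_one_mul_G_pi_div_three_eq`), ★★★ `(2ω − 1)·(G ω + G (rev ω))` = Duminil-Copin–Smirnov's PAIR of the
surviving terms of `ω` and `rev ω` (`two_mul_omg_sub_one_mul_G_add_G_rev_pi_div_three_eq`; at most one of the two is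
diagonal-ending, `arcKind_ne_corner_of_corner`), ★★ the lane's signed class term at the hexagonal angle is that pair over
`2i(2ω − 1)` (`two_I_mul_classTerm_pi_div_three_eq`, `dcsPair_pi_div_three_eq_backBracket`), and ★★ the pair of an UNWOUND
walk cancels (`dcsPair_pi_div_three_eq_zero_of_unwound`) — Duminil-Copin–Smirnov's cancellation of non-encircling pairs
recovered from Glazman–Manolescu's second local relation `groupTwo_gen`, consistently with «encircling ⟺ wound» of the
winding file. The local input is one identity among lattice constants per ordered class `(z₀, z₁, z₂, z₃)`
(`triangle_relation_pi_div_three`, 24 classes: trivial for the 16 non-corner ones by `pairWeight_pi_div_three_eq_zero`, the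
rotated triplet identities `triplet_identity_rotated_S/E` for the 8 corner ones). -/

section GroupPair

/-! ### §4.1 Lattice constants at `θ = π/3`: phases as powers of `λ`, the rotated triplet identities -/

/-- **The parafermionic phase of a multiple of `π/3` is a power of `λ`**: `e^{−i(5/8)·nπ/3} = λⁿ`, `λ = e^{−i5π/24}`.
[cite: DuminilCopinSmirnov2012, §2 («λ = exp(−i5π/24)»)] [cite: GlazmanManolescu2019, §2.1, eq. (2.1) (σ = 5/8)] -/
theorem phase_int_mul_pi_div_three (n : ℤ) : phase (n * (π / 3)) = HV.lam ^ n := by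
  rw [HV.lam_zpow, phase]
  congr 1
  push_cast
  simp only [HV.θ₅]
  push_cast
  ring

/-- `phase (π/3) = λ`: one counterclockwise honeycomb turn. [cite: DuminilCopinSmirnov2012, §2 («λ = exp(−i5π/24)»)] -/
theorem phase_pi_div_three : phase (π / 3) = HV.lam := by
  have h := phase_int_mul_pi_div_three 1
  simp only [Int.cast_one, one_mul, zpow_one] at h
  exact h

/-- `phase (−π/3) = λ⁻¹`: one clockwise honeycomb turn. [cite: DuminilCopinSmirnov2012, §2 («λ = exp(−i5π/24)»)] -/
theorem phase_neg_pi_div_three : phase (-(π / 3)) = HV.lam⁻¹ := by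
  have h := phase_int_mul_pi_div_three (-1)
  simp only [Int.cast_neg, Int.cast_one, neg_mul, one_mul, zpow_neg, zpow_one] at h
  exact h

/-- **The triplet identity, rotated to a return across `S`** (or `N`): `(2ω − 1)(−ω + x_c λ⁻¹) = (1 + ω) x_c λ` — the form in
which Duminil-Copin–Smirnov's `1 + x_c(ω²λ⁻¹ − ωλ) = 0` (`HV.triplet_identity`) enters the triangle relation below; a
consequence of it and `ω² = ω − 1`. [cite: DuminilCopinSmirnov2012, proof of Lemma 1 (the triplet identity, «the only place where
we use x = x_c»)] -/
theorem triplet_identity_rotated_S :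
    (2 * HV.omg - 1) * (-HV.omg + (hexCriticalFugacity : ℂ) * HV.lam⁻¹) =
      (1 + HV.omg) * (hexCriticalFugacity : ℂ) * HV.lam := by
  have hT := HV.triplet_identity
  rw [zpow_neg, zpow_one] at hT
  have hω := HV.omg_sq
  linear_combination (2 - HV.omg) * hT +
    (-2 + (hexCriticalFugacity : ℂ) * HV.lam⁻¹ * (HV.omg - 1) - (hexCriticalFugacity : ℂ) * HV.lam) * hω

/-- **The triplet identity, rotated to a return across `E`** (or `W`): `(2ω − 1)(1 − ω x_c λ) = (1 + ω) x_c λ⁻¹`.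
[cite: DuminilCopinSmirnov2012, proof of Lemma 1 (the triplet identity)] -/
theorem triplet_identity_rotated_E :
    (2 * HV.omg - 1) * (1 - HV.omg * (hexCriticalFugacity : ℂ) * HV.lam) =
      (1 + HV.omg) * (hexCriticalFugacity : ℂ) * HV.lam⁻¹ := by
  have hT := HV.triplet_identity
  rw [zpow_neg, zpow_one] at hT
  have hω := HV.omg_sq
  linear_combination (2 * HV.omg - 1) * hT +
    ((hexCriticalFugacity : ℂ) * HV.lam⁻¹ * (-2 * HV.omg - 1)) * hω

/-! ### §4.2 The triangle relation among the lattice constants of one ordered class `(z₀, z₁, z₂, z₃)` -/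

/-- The two arcs of a full rhombus have the same kind: if `z₀, z₁, z₂, z₃` are the four sides, `arcKind z₂ z₃ = arcKind z₀ z₁`
(complementary pairs: both `θ`-corners, both `(π−θ)`-corners, or both straight). [cite: GlazmanManolescu2019, Fig. 1] -/
theorem arcKind_eq_arcKind_of_pairwise_ne {z₀ z₁ z₂ z₃ : Side} (h01 : z₀ ≠ z₁) (h02 : z₀ ≠ z₂) (h03 : z₀ ≠ z₃)
    (h12 : z₁ ≠ z₂) (h13 : z₁ ≠ z₃) (h23 : z₂ ≠ z₃) : arcKind z₂ z₃ = arcKind z₀ z₁ := by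
  revert h01 h02 h03 h12 h13 h23
  cases z₀ <;> cases z₁ <;> cases z₂ <;> cases z₃ <;> decide

/-- **At `θ = π/3` the weight of the two-arc extension vanishes unless the arcs cut off the `θ`-corners**: for the four
sides `z₀, z₁, z₂, z₃` with `arcKind z₀ z₁ ≠ corner`, `pairWeight (π/3) z₀ z₁ z₂ z₃ = 0` — two `(π−θ)`-corner arcs weigh
`w₂(π/3) = 0`, two straight arcs are the excluded crossing. [cite: GlazmanManolescu2019, §1 («if θ = π/3, then w₂ = 0») and Fig. 1] -/
theorem pairWeight_pi_div_three_eq_zero {z₀ z₁ z₂ z₃ : Side} (hk : arcKind z₀ z₁ ≠ .corner) (h01 : z₀ ≠ z₁)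
    (h02 : z₀ ≠ z₂) (h03 : z₀ ≠ z₃) (h12 : z₁ ≠ z₂) (h13 : z₁ ≠ z₃) (h23 : z₂ ≠ z₃) :
    pairWeight (π / 3) z₀ z₁ z₂ z₃ = 0 := by
  rw [pairWeight, arcKind_eq_arcKind_of_pairwise_ne h01 h02 h03 h12 h13 h23]
  have hd : arcKind z₀ z₁ ≠ .degen := arcKind_ne_degen h01
  revert hk hd
  generalize arcKind z₀ z₁ = κ
  cases κ <;> intro hk hd
  · exact absurd rfl hk
  · simp [localWeight, weightW2_pi_div_three]
  · rfl
  · exact absurd rfl hd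

/-- If the arc `z₀ → z₁` cuts off a `θ`-corner then `z₀ → z₂` does not (`z₂ ∉ {z₀, z₁}` lies on the other triangle): in a
Duminil-Copin–Smirnov pair at most one member is diagonal-ending. [cite: GlazmanManolescu2019, §1 (Fig. 2)] -/
theorem arcKind_ne_corner_of_corner {z₀ z₁ z₂ : Side} (h02 : z₀ ≠ z₂) (h12 : z₁ ≠ z₂)
    (hk : arcKind z₀ z₁ = .corner) : arcKind z₀ z₂ ≠ .corner := by
  revert h02 h12 hk
  cases z₀ <;> cases z₁ <;> cases z₂ <;> decide

/-- **The triangle relation at `π/3`, `θ`-corner classes** (8 of the 24 ordered classes `(z₀, z₁, z₂, z₃)`): when `z₀ → z₁` cuts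
off a `θ`-corner, `(2ω − 1)·(crCoef z₂ · u₁ + crCoef z₃ · w₁ · phase(arcTurn z₂ z₃)) = ±(1 + ω)·x_c·λ^{∓1} · u₁` with
`u₁ = x_c`, `w₁ = x_c²`, the sign `−` iff `z₀.tri`, the exponent `−1` iff `z₂ ∈ {W, E}` — the constants of the walk, of its
two-arc extension, and of the walk pushed across the diagonal (§2 `cornerTerm_eq`): Duminil-Copin–Smirnov's triplet
relation at the return triangle, by `triplet_identity_rotated_S/E`. [cite: DuminilCopinSmirnov2012, proof of Lemma 1 (the triplets)]
[cite: GlazmanManolescu2019, Lemma 2.1, eq. (CR) and §1 («v = w₁ = u₂ = u₁²»)] -/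
theorem triangle_relation_pi_div_three_corner {z₀ z₁ z₂ z₃ : Side} (hk : arcKind z₀ z₁ = .corner)
    (h02 : z₀ ≠ z₂) (h03 : z₀ ≠ z₃) (h12 : z₁ ≠ z₂) (h13 : z₁ ≠ z₃) (h23 : z₂ ≠ z₃) :
    (2 * HV.omg - 1) * (crCoef (π / 3) z₂ * (arcWeight (π / 3) z₀ z₁ : ℂ) +
        crCoef (π / 3) z₃ * (pairWeight (π / 3) z₀ z₁ z₂ z₃ : ℂ) * phase (arcTurn (π / 3) z₂ z₃)) =
      (if z₀.tri then -1 else 1) * (1 + HV.omg) * (hexCriticalFugacity : ℂ) *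
        HV.lam ^ (if z₂ = .W ∨ z₂ = .E then (-1 : ℤ) else 1) * (arcWeight (π / 3) z₀ z₁ : ℂ) := by
  have hN : crCoef (π / 3) .N = HV.omg := rfl
  have hS : crCoef (π / 3) .S = -HV.omg := rfl
  have hE : crCoef (π / 3) .E = 1 := rfl
  have hW : crCoef (π / 3) .W = -1 := rfl
  have I1 := triplet_identity_rotated_S
  have I2 := triplet_identity_rotated_E
  revert hk h02 h03 h12 h13 h23
  cases z₀ <;> cases z₁ <;> cases z₂ <;> cases z₃ <;> intro hk h02 h03 h12 h13 h23 <;>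
    simp only [arcKind, reduceCtorEq] at hk <;>
    (try exact absurd rfl h02) <;> (try exact absurd rfl h03) <;> (try exact absurd rfl h12) <;>
    (try exact absurd rfl h13) <;> (try exact absurd rfl h23) <;>
    simp only [hN, hS, hE, hW, arcWeight, pairWeight, arcKind, localWeight, weightU1_pi_div_three,
      weightW1_pi_div_three, arcTurn, phase_pi_div_three, phase_neg_pi_div_three, Side.tri, Bool.false_eq_true,
      if_false, if_true, reduceCtorEq, or_self, or_false, or_true, zpow_neg, zpow_one] <;>
    push_cast <;>
    first
      | linear_combination (hexCriticalFugacity : ℂ) * I1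
      | linear_combination (-(hexCriticalFugacity : ℂ)) * I1
      | linear_combination (hexCriticalFugacity : ℂ) * I2
      | linear_combination (-(hexCriticalFugacity : ℂ)) * I2

/-- ★ **THE TRIANGLE RELATION AT `π/3` FOR EVERY ORDERED CLASS** `(z₀, z₁, z₂, z₃)` of four distinct sides:
`(2ω − 1)·(crCoef z₂ · arcWeight z₀z₁ + crCoef z₃ · pairWeight z₀z₁z₂z₃ · phase(arcTurn z₂ z₃))` — `2ω − 1` times the constants of
Glazman–Manolescu's half-group `{ω, ext₃ ω}` — equals the constant of Duminil-Copin–Smirnov's surviving term of `ω`: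
`(2ω − 1)·crCoef z₂ · arcWeight z₀z₁` (side-ending) if `z₀ → z₁` is not a `θ`-corner (the extension weighs nothing,
`pairWeight_pi_div_three_eq_zero`), `±(1 + ω)·x_c·λ^{∓1} · arcWeight z₀z₁` (diagonal-ending) if it is
(`triangle_relation_pi_div_three_corner`). [cite: DuminilCopinSmirnov2012, proof of Lemma 1 (pairs and triplets)]
[cite: GlazmanManolescu2019, Lemma 2.1, eq. (CR)] [cite: Glazman2015WeightedSAW, Lemma 3.1 (proof, pp. 6–7)] -/
theorem triangle_relation_pi_div_three {z₀ z₁ z₂ z₃ : Side} (h01 : z₀ ≠ z₁) (h02 : z₀ ≠ z₂) (h03 : z₀ ≠ z₃)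
    (h12 : z₁ ≠ z₂) (h13 : z₁ ≠ z₃) (h23 : z₂ ≠ z₃) :
    (2 * HV.omg - 1) * (crCoef (π / 3) z₂ * (arcWeight (π / 3) z₀ z₁ : ℂ) +
        crCoef (π / 3) z₃ * (pairWeight (π / 3) z₀ z₁ z₂ z₃ : ℂ) * phase (arcTurn (π / 3) z₂ z₃)) =
      (if arcKind z₀ z₁ = .corner then
          (if z₀.tri then -1 else 1) * (1 + HV.omg) * (hexCriticalFugacity : ℂ) *
            HV.lam ^ (if z₂ = .W ∨ z₂ = .E then (-1 : ℤ) else 1)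
        else (2 * HV.omg - 1) * crCoef (π / 3) z₂) * (arcWeight (π / 3) z₀ z₁ : ℂ) := by
  by_cases hk : arcKind z₀ z₁ = .corner
  · rw [if_pos hk]
    exact triangle_relation_pi_div_three_corner hk h02 h03 h12 h13 h23
  · rw [if_neg hk, pairWeight_pi_div_three_eq_zero hk h01 h02 h03 h12 h13 h23]
    push_cast
    ring

/-- ★★ **GLAZMAN–MANOLESCU'S BRACKET AT `π/3` IS A DUMINIL-COPIN–SMIRNOV PAIR**: for four distinct sides and every real `X`,
`(2ω − 1)·bracket(π/3; z₀, z₁, z₂, z₃; X) = C(z₀,z₁,z₂)·arcWeight z₀z₁·phase(arcTurn z₀z₁ + X) + C(z₀,z₂,z₁)·arcWeight z₀z₂·phase(arcTurn z₀z₂ − X)`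
with the surviving-term constants `C` of `triangle_relation_pi_div_three` (the two halves of the bracket are the half-groups
of `ω` and of `rev ω`). [cite: GlazmanManolescu2019, Lemma 2.1 (proof: [Gl], Lemma 3.1)] [cite: DuminilCopinSmirnov2012, proof of Lemma 1 (pairs and triplets)] -/
theorem two_mul_omg_sub_one_mul_bracket_pi_div_three {z₀ z₁ z₂ z₃ : Side} (h01 : z₀ ≠ z₁) (h02 : z₀ ≠ z₂)
    (h03 : z₀ ≠ z₃) (h12 : z₁ ≠ z₂) (h13 : z₁ ≠ z₃) (h23 : z₂ ≠ z₃) (X : ℝ) :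
    (2 * HV.omg - 1) * bracket (π / 3) z₀ z₁ z₂ z₃ X =
      (if arcKind z₀ z₁ = .corner then
          (if z₀.tri then -1 else 1) * (1 + HV.omg) * (hexCriticalFugacity : ℂ) *
            HV.lam ^ (if z₂ = .W ∨ z₂ = .E then (-1 : ℤ) else 1)
        else (2 * HV.omg - 1) * crCoef (π / 3) z₂) * (arcWeight (π / 3) z₀ z₁ : ℂ) * phase (arcTurn (π / 3) z₀ z₁ + X) +
      (if arcKind z₀ z₂ = .corner then
          (if z₀.tri then -1 else 1) * (1 + HV.omg) * (hexCriticalFugacity : ℂ) *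
            HV.lam ^ (if z₁ = .W ∨ z₁ = .E then (-1 : ℤ) else 1)
        else (2 * HV.omg - 1) * crCoef (π / 3) z₁) * (arcWeight (π / 3) z₀ z₂ : ℂ) * phase (arcTurn (π / 3) z₀ z₂ - X) := by
  have h1 := triangle_relation_pi_div_three h01 h02 h03 h12 h13 h23
  have h2 := triangle_relation_pi_div_three h02 h01 h03 h12.symm h23 h13
  unfold bracket
  rw [phase_add (arcTurn (π / 3) z₀ z₁ + X), phase_add (arcTurn (π / 3) z₀ z₂ - X)]
  linear_combination phase (arcTurn (π / 3) z₀ z₁ + X) * h1 + phase (arcTurn (π / 3) z₀ z₂ - X) * h2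

/-! ### §4.3 Per walk: the half-group of a returning walk is its surviving honeycomb term -/

namespace ΩG

open YBWalk HV
open private kindsIn_of_isB2a from Literature.Probability.RandomPlanarGeometry.YangBaxterSAWGeneralDomain

variable {Dl : List Face} {f : Face} {ω : ΩG (PlaquetteWalk.dom Dl) origin f}

/-- **Reversal keeps the `π/3`-weight non-zero**: `rev ω` has the same exterior weight and one arc (`z₀ → z₂`) in `f`, of weight
`x_c` or `x_c²`. [cite: Glazman2015WeightedSAW, Lemma 3.1 (proof, pp. 6–7: the reversed companion)] [cite: GlazmanManolescu2019, §1 («v = w₁ = u₂ = u₁²»)] -/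
theorem weight_rev_pi_div_three_ne_zero (hr : RootedFace (PlaquetteWalk.dom Dl) origin f) (h : ω.IsB2a)
    (hw : ω.2.weight (fun _ => π / 3) ≠ 0) : (ω.rev hr).2.weight (fun _ => π / 3) ≠ 0 := by
  have h' := ω.rev_isB2a hr h
  have hext : ω.2.extWeight (fun _ => π / 3) f ≠ 0 := fun e =>
    hw (by rw [ω.2.weight_eq_extWeight_mul _ f, e, zero_mul])
  have hd := ω.2.sides_distinctG hr h.1
  rw [ω.returnSide_of_isB2a h] at hd
  rw [(ω.rev hr).2.weight_eq_extWeight_mul _ f, ω.rev_extWeight _ hr h, kindsIn_of_isB2a (ω.rev hr) hr h',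
    ω.rev_firstSide hr h, ω.rev_exitSide hr h]
  exact mul_ne_zero hext (localWeight_pi_div_three_single_ne_zero (arcKind_ne_degen hd.2.1.symm))

/-- **The surviving honeycomb term of a returning walk in Glazman–Manolescu's variables.** For a class-`B2a` walk `ω` at `f`
from the origin of non-zero `π/3`-weight, Duminil-Copin–Smirnov's term of `ω` — the side-ending term
`edir (f.hv ω.1) (finalDart hvWalk).1 · pwt hvWalk` at the return triangle if the arc `z₀ → z₁` is not a `θ`-corner, the
diagonal-ending term `edir (f.hv z₀) (f.hv ω.1) · pwt (hvWalk ++ [f.hv z₀])` of the pushed walk if it is (§2) — equals the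
constant `C(z₀, z₁, z₂)` of `triangle_relation_pi_div_three` times `extWeight · arcWeight z₀z₁ · phase(WP + arcTurn z₀z₁ + WE)`
(`ΩG.edir_mul_pwt_hvWalk_eq`, `cornerTerm_eq`, `paraWeight_of_isB2a`). [cite: DuminilCopinSmirnov2012, proof of Lemma 1 («c(γ)»)]
[cite: GlazmanManolescu2019, Lemma 2.1, eq. (2.2)] [cite: Glazman2015WeightedSAW, Lemma 3.1 (proof, pp. 6–7)] -/
theorem dcsTerm_pi_div_three_eq (hD : ((-1 : ℤ), (0 : ℤ)) ∉ Dl) (hr : RootedFace (PlaquetteWalk.dom Dl) origin f)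
    (h : ω.IsB2a) (hw : ω.2.weight (fun _ => π / 3) ≠ 0) :
    (if arcKind ω.2.firstSideG (ω.z1 hr h) = .corner then
        HV.edir (f.hv ω.2.firstSideG) (f.hv ω.1) * HV.pwt (ω.2.hvWalk ++ [f.hv ω.2.firstSideG])
      else HV.edir (f.hv ω.1) (HV.finalDart ω.2.hvWalk).1 * HV.pwt ω.2.hvWalk) =
      (if arcKind ω.2.firstSideG (ω.z1 hr h) = .corner then
          (if ω.2.firstSideG.tri then -1 else 1) * (1 + HV.omg) * (hexCriticalFugacity : ℂ) *
            HV.lam ^ (if ω.1 = .W ∨ ω.1 = .E then (-1 : ℤ) else 1)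
        else (2 * HV.omg - 1) * crCoef (π / 3) ω.1) *
        ((ω.2.extWeight (fun _ => π / 3) f : ℂ) * (arcWeight (π / 3) ω.2.firstSideG (ω.z1 hr h) : ℂ) *
          phase (ω.WP (fun _ => π / 3) + arcTurn (π / 3) ω.2.firstSideG (ω.z1 hr h) + ω.WE (fun _ => π / 3))) := by
  have hD' : ((-1 : ℤ), (0 : ℤ)) ∉ PlaquetteWalk.dom Dl := hD
  have hpw : ω.2.paraWeight (fun _ => π / 3) =
      (ω.2.extWeight (fun _ => π / 3) f : ℂ) * (arcWeight (π / 3) ω.2.firstSideG (ω.z1 hr h) : ℂ) *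
        phase (ω.WP (fun _ => π / 3) + arcTurn (π / 3) ω.2.firstSideG (ω.z1 hr h) + ω.WE (fun _ => π / 3)) :=
    ω.paraWeight_of_isB2a (fun _ => π / 3) hr h
  by_cases hc : arcKind ω.2.firstSideG (ω.z1 hr h) = .corner
  · rw [if_pos hc, if_pos hc, cornerTerm_eq hr hD h hw (tri_fst_ne_of_corner h hc).symm, hpw]
  · rw [if_neg hc, if_neg hc, ΩG.edir_mul_pwt_hvWalk_eq hD' hr h hw, hpw]

/-- **At `π/3` the one-arc extension of a non-`θ`-corner returning walk contributes nothing**: `T₃ ω = 0` (two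
`(π−θ)`-corner arcs in `f` weigh `w₂(π/3) = 0`; two straight arcs would cross). [cite: GlazmanManolescu2019, §1 («w₂ = 0») and Fig. 1]
[cite: Glazman2015WeightedSAW, Lemma 3.1 (proof, pp. 6–7: the extensions of the group)] -/
theorem T₃_pi_div_three_eq_zero_of_ne_corner (hr : RootedFace (PlaquetteWalk.dom Dl) origin f) (h : ω.IsB2a)
    (hc : arcKind ω.2.firstSideG (ω.z1 hr h) ≠ .corner) : ω.T₃ (fun _ => π / 3) hr = 0 := by
  have hd := ω.2.sides_distinctG hr h.1
  rw [ω.returnSide_of_isB2a h] at hd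
  have hz := ω.z₃_spec hr h
  have h01 : ω.2.firstSideG ≠ ω.z1 hr h := fun e => hd.1 e.symm
  have h03 : ω.2.firstSideG ≠ ω.z₃ hr h := fun e => hz.1 e.symm
  have h13 : ω.z1 hr h ≠ ω.z₃ hr h := fun e => hz.2.1 e.symm
  have h12 : ω.z1 hr h ≠ ω.1 := fun e => hd.2.2 e.symm
  have hT : ω.T₃ (fun _ => π / 3) hr = crCoef (π / 3) (ω.z₃ hr h) * ((ω.2.extWeight (fun _ => π / 3) f : ℂ) *
      (pairWeight (π / 3) ω.2.firstSideG (ω.z1 hr h) ω.1 (ω.z₃ hr h) : ℂ) *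
      phase (ω.WP (fun _ => π / 3) + arcTurn (π / 3) ω.2.firstSideG (ω.z1 hr h) + ω.WE (fun _ => π / 3) +
        arcTurn (π / 3) ω.1 (ω.z₃ hr h))) :=
    ω.T₃_eq (fun _ => π / 3) hr h
  rw [hT, pairWeight_pi_div_three_eq_zero hc h01 hd.2.1.symm h03 h12 h13 hz.2.2.symm]
  push_cast
  ring

/-- ★★★ **THE HALF-GROUP OF A RETURNING WALK IS ITS SURVIVING HONEYCOMB TERM.** For every finite rhombus list `Dl` not
containing `(−1, 0)`, rooted at the origin, every rhombus `f` and every class-`B2a` walk `ω` at `f` of non-zero `π/3`-weight: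
`(2ω − 1)·G_{π/3}(ω)` — `2ω − 1 = i√3` times Glazman–Manolescu's half-group `g ω + T₃ ω` (the walk and its one-arc extension
through `f`) — EQUALS Duminil-Copin–Smirnov's single surviving term of `ω`: the side-ending term of its honeycomb walk at the
return triangle if the arc `z₀ → z₁` is not a `θ`-corner (then `T₃ ω = 0`), the diagonal-ending term of the honeycomb walk pushed
across the short diagonal if it is (then `ω` and `ext₃ ω` are two members of a DCS triplet at the return triangle, whose third
member is the pushed walk). [cite: DuminilCopinSmirnov2012, proof of Lemma 1 (pairs and triplets)] [cite: GlazmanManolescu2019, §1 (θ = π/3),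
Lemma 2.1 and eq. (2.2)] [cite: Glazman2015WeightedSAW, Lemma 3.1 (proof, pp. 6–7)] -/
theorem two_mul_omg_sub_one_mul_G_pi_div_three_eq (hD : ((-1 : ℤ), (0 : ℤ)) ∉ Dl)
    (hr : RootedFace (PlaquetteWalk.dom Dl) origin f) (h : ω.IsB2a) (hw : ω.2.weight (fun _ => π / 3) ≠ 0) :
    (2 * HV.omg - 1) * ω.G (fun _ => π / 3) hr =
      (if arcKind ω.2.firstSideG (ω.z1 hr h) = .corner then
          HV.edir (f.hv ω.2.firstSideG) (f.hv ω.1) * HV.pwt (ω.2.hvWalk ++ [f.hv ω.2.firstSideG])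
        else HV.edir (f.hv ω.1) (HV.finalDart ω.2.hvWalk).1 * HV.pwt ω.2.hvWalk) := by
  have hd := ω.2.sides_distinctG hr h.1
  rw [ω.returnSide_of_isB2a h] at hd
  have hz := ω.z₃_spec hr h
  have h01 : ω.2.firstSideG ≠ ω.z1 hr h := fun e => hd.1 e.symm
  have h03 : ω.2.firstSideG ≠ ω.z₃ hr h := fun e => hz.1 e.symm
  have h13 : ω.z1 hr h ≠ ω.z₃ hr h := fun e => hz.2.1 e.symm
  have h12 : ω.z1 hr h ≠ ω.1 := fun e => hd.2.2 e.symm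
  have hb := triangle_relation_pi_div_three h01 hd.2.1.symm h03 h12 h13 hz.2.2.symm
  have hpw : ω.2.paraWeight (fun _ => π / 3) =
      (ω.2.extWeight (fun _ => π / 3) f : ℂ) * (arcWeight (π / 3) ω.2.firstSideG (ω.z1 hr h) : ℂ) *
        phase (ω.WP (fun _ => π / 3) + arcTurn (π / 3) ω.2.firstSideG (ω.z1 hr h) + ω.WE (fun _ => π / 3)) :=
    ω.paraWeight_of_isB2a (fun _ => π / 3) hr h
  have hT : ω.T₃ (fun _ => π / 3) hr = crCoef (π / 3) (ω.z₃ hr h) * ((ω.2.extWeight (fun _ => π / 3) f : ℂ) *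
      (pairWeight (π / 3) ω.2.firstSideG (ω.z1 hr h) ω.1 (ω.z₃ hr h) : ℂ) *
      phase (ω.WP (fun _ => π / 3) + arcTurn (π / 3) ω.2.firstSideG (ω.z1 hr h) + ω.WE (fun _ => π / 3) +
        arcTurn (π / 3) ω.1 (ω.z₃ hr h))) :=
    ω.T₃_eq (fun _ => π / 3) hr h
  have hg : ω.g (fun _ => π / 3) = crCoef (π / 3) ω.1 * ω.2.paraWeight (fun _ => π / 3) := rfl
  rw [dcsTerm_pi_div_three_eq hD hr h hw, ΩG.G, hg, hT, hpw,
    phase_add (ω.WP _ + arcTurn (π / 3) _ _ + ω.WE _) (arcTurn (π / 3) ω.1 _)]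
  linear_combination (ω.2.extWeight (fun _ => π / 3) f : ℂ) *
    phase (ω.WP (fun _ => π / 3) + arcTurn (π / 3) ω.2.firstSideG (ω.z1 hr h) + ω.WE (fun _ => π / 3)) * hb

/-- The exit side of the reversed companion is the return side of the walk. [cite: Glazman2015WeightedSAW, Lemma 3.1 (proof, pp. 6–7: the reversed companion)] -/
theorem rev_z1 (hr : RootedFace (PlaquetteWalk.dom Dl) origin f) (h : ω.IsB2a) :
    (ω.rev hr).z1 hr (ω.rev_isB2a hr h) = ω.1 := ω.rev_exitSide hr h

/-- The return triangle of the reversed companion is the triangle of the walk's exit side. [cite: Glazman2015WeightedSAW, Lemma 3.1 (proof, pp. 6–7)]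
[cite: GlazmanManolescu2019, §1 (Fig. 2)] -/
theorem hv_rev_fst (hr : RootedFace (PlaquetteWalk.dom Dl) origin f) (h : ω.IsB2a) :
    f.hv (ω.rev hr).1 = f.hv (ω.z1 hr h) := by
  rw [ω.rev_fst hr h]; rfl

/-- ★★★ **GROUP = PAIR: GLAZMAN–MANOLESCU'S GROUP OF A RETURNING WALK IS, AT `θ = π/3`, DUMINIL-COPIN–SMIRNOV'S PAIR.** Same
setting: `(2ω − 1)·(G_{π/3} ω + G_{π/3} (rev ω))` — `2ω − 1` times the sum of the four-member group of `ω` (the walk, its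
reversed companion, their one-arc extensions; `= extWeight·phase(WP)·bracket(π/3; z₀,z₁,z₂,z₃; WE)` by `G_add_G_rev_eq_bracket`) —
equals the sum of the surviving honeycomb terms of `ω` (corner test on the arc `z₀ → z₁`) and of `rev ω` (corner test on its arc
`z₀ → z₂`; its return triangle is `f.hv z₁`): the two members of one Duminil-Copin–Smirnov pair at the triangle they share,
at most one of them diagonal-ending (`arcKind_ne_corner_of_corner`). Summed over the wound walks this is §3; group by group it
says that Glazman–Manolescu's proof of Lemma 2.1, specialised to `π/3`, is Duminil-Copin–Smirnov's proof of Lemma 1 read through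
the dictionary. [cite: DuminilCopinSmirnov2012, Lemma 1 and its proof (pairs and triplets)] [cite: GlazmanManolescu2019, §1 (θ = π/3), Lemma 2.1
and eq. (2.2)] [cite: Glazman2015WeightedSAW, Lemma 3.1 (proof, pp. 6–7)] -/
theorem two_mul_omg_sub_one_mul_G_add_G_rev_pi_div_three_eq (hD : ((-1 : ℤ), (0 : ℤ)) ∉ Dl)
    (hr : RootedFace (PlaquetteWalk.dom Dl) origin f) (h : ω.IsB2a) (hw : ω.2.weight (fun _ => π / 3) ≠ 0) :
    (2 * HV.omg - 1) * (ω.G (fun _ => π / 3) hr + (ω.rev hr).G (fun _ => π / 3) hr) =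
      (if arcKind ω.2.firstSideG (ω.z1 hr h) = .corner then
          HV.edir (f.hv ω.2.firstSideG) (f.hv ω.1) * HV.pwt (ω.2.hvWalk ++ [f.hv ω.2.firstSideG])
        else HV.edir (f.hv ω.1) (HV.finalDart ω.2.hvWalk).1 * HV.pwt ω.2.hvWalk) +
      (if arcKind ω.2.firstSideG ω.1 = .corner then
          HV.edir (f.hv ω.2.firstSideG) (f.hv (ω.z1 hr h)) * HV.pwt ((ω.rev hr).2.hvWalk ++ [f.hv ω.2.firstSideG])
        else HV.edir (f.hv (ω.z1 hr h)) (HV.finalDart (ω.rev hr).2.hvWalk).1 * HV.pwt (ω.rev hr).2.hvWalk) := by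
  have h' := ω.rev_isB2a hr h
  have hw' := weight_rev_pi_div_three_ne_zero hr h hw
  have e1 := two_mul_omg_sub_one_mul_G_pi_div_three_eq hD hr h hw
  have e2 := two_mul_omg_sub_one_mul_G_pi_div_three_eq hD hr h' hw'
  rw [rev_z1 hr h, ω.rev_firstSide hr h, hv_rev_fst hr h] at e2
  rw [mul_add, e1, e2]

/-- ★★ **THE SIGNED CLASS TERM AT THE HEXAGONAL ANGLE IS THE DUMINIL-COPIN–SMIRNOV PAIR**: `2i·(2ω − 1)·classTerm_{π/3}(ω)`
(`ΩG.G_add_G_rev_eq_classTerm`: the group is `2i` times the signed class term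
`extWeight·phase(WP)·sin((5/8)(WE − excursionWinding))·backBracket`) equals the sum of the surviving honeycomb terms of `ω` and
`rev ω`. [cite: GlazmanManolescu2019, Lemma 2.1 (statement, "in the form given in [Gl]")] [cite: Glazman2015WeightedSAW, Lemma 3.1 (proof)]
[cite: DuminilCopinSmirnov2012, Lemma 1 and its proof (the pairs)] -/
theorem two_I_mul_classTerm_pi_div_three_eq (hD : ((-1 : ℤ), (0 : ℤ)) ∉ Dl)
    (hr : RootedFace (PlaquetteWalk.dom Dl) origin f) (h : ω.IsB2a) (hw : ω.2.weight (fun _ => π / 3) ≠ 0) :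
    2 * Complex.I * (2 * HV.omg - 1) * ω.classTerm (fun _ => π / 3) hr =
      (if arcKind ω.2.firstSideG (ω.z1 hr h) = .corner then
          HV.edir (f.hv ω.2.firstSideG) (f.hv ω.1) * HV.pwt (ω.2.hvWalk ++ [f.hv ω.2.firstSideG])
        else HV.edir (f.hv ω.1) (HV.finalDart ω.2.hvWalk).1 * HV.pwt ω.2.hvWalk) +
      (if arcKind ω.2.firstSideG ω.1 = .corner then
          HV.edir (f.hv ω.2.firstSideG) (f.hv (ω.z1 hr h)) * HV.pwt ((ω.rev hr).2.hvWalk ++ [f.hv ω.2.firstSideG])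
        else HV.edir (f.hv (ω.z1 hr h)) (HV.finalDart (ω.rev hr).2.hvWalk).1 * HV.pwt (ω.rev hr).2.hvWalk) := by
  rw [← two_mul_omg_sub_one_mul_G_add_G_rev_pi_div_three_eq hD hr h hw, ω.G_add_G_rev_eq_classTerm _ hr h]
  ring

/-- ★★ **The Duminil-Copin–Smirnov pair of a returning walk in closed form**: the sum of the surviving honeycomb terms of `ω`
and `rev ω` is `2i·(2ω − 1)·extWeight·phase(WP)·sin((5/8)(WE − excursionWinding(π/3; z₀, z₁, z₂)))·backBracket(π/3; z₀, z₁, z₂, z₃)` —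
a mass, the prefix phase, the SIGN of the group (`0` unwound, `±1` wound: `ΩG.sin_WE_sub_excursionWinding`) and one of the
lane's explicit class directions, now at the hexagonal angle. [cite: GlazmanManolescu2019, Lemma 2.1 (statement, "in the form given in [Gl]")]
[cite: Glazman2015WeightedSAW, Lemma 3.1 (proof)] [cite: DuminilCopinSmirnov2012, Lemma 1 and its proof (the pairs)] -/
theorem dcsPair_pi_div_three_eq_backBracket (hD : ((-1 : ℤ), (0 : ℤ)) ∉ Dl)
    (hr : RootedFace (PlaquetteWalk.dom Dl) origin f) (h : ω.IsB2a) (hw : ω.2.weight (fun _ => π / 3) ≠ 0) :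
    (if arcKind ω.2.firstSideG (ω.z1 hr h) = .corner then
          HV.edir (f.hv ω.2.firstSideG) (f.hv ω.1) * HV.pwt (ω.2.hvWalk ++ [f.hv ω.2.firstSideG])
        else HV.edir (f.hv ω.1) (HV.finalDart ω.2.hvWalk).1 * HV.pwt ω.2.hvWalk) +
      (if arcKind ω.2.firstSideG ω.1 = .corner then
          HV.edir (f.hv ω.2.firstSideG) (f.hv (ω.z1 hr h)) * HV.pwt ((ω.rev hr).2.hvWalk ++ [f.hv ω.2.firstSideG])
        else HV.edir (f.hv (ω.z1 hr h)) (HV.finalDart (ω.rev hr).2.hvWalk).1 * HV.pwt (ω.rev hr).2.hvWalk) =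
      2 * Complex.I * (2 * HV.omg - 1) * ((ω.2.extWeight (fun _ => π / 3) f : ℂ) * phase (ω.WP (fun _ => π / 3)) *
        (Real.sin (5 / 8 * (ω.WE (fun _ => π / 3) - excursionWinding (π / 3) ω.2.firstSideG (ω.z1 hr h) ω.1)) : ℂ) *
          backBracket (π / 3) ω.2.firstSideG (ω.z1 hr h) ω.1 (ω.z₃ hr h)) := by
  rw [← two_I_mul_classTerm_pi_div_three_eq hD hr h hw, ΩG.classTerm, dif_pos h]
  rfl

/-- ★★ **THE PAIR OF AN UNWOUND RETURNING WALK CANCELS** — Duminil-Copin–Smirnov's cancellation of a non-encircling pair,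
here DERIVED from Glazman–Manolescu's second local relation (`ΩG.G_add_G_rev_of_unwound`, i.e. `groupTwo_gen` at the tabulated
winding) through the termwise dictionary; consistent with «encircling ⟺ wound» of the winding file, by which the two
honeycomb terms are then non-encircling. [cite: DuminilCopinSmirnov2012, proof of Lemma 1 («c(γ₁) + c(γ₂) = 0» for the pairs)]
[cite: GlazmanManolescu2019, Lemma 2.1 (proof: [Gl], Lemma 3.1)] [cite: Glazman2015WeightedSAW, Lemma 3.1 (proof, pp. 6–7)] -/
theorem dcsPair_pi_div_three_eq_zero_of_unwound (hD : ((-1 : ℤ), (0 : ℤ)) ∉ Dl)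
    (hr : RootedFace (PlaquetteWalk.dom Dl) origin f) (h : ω.IsB2a) (hw : ω.2.weight (fun _ => π / 3) ≠ 0)
    (hU : ω.Unwound hr) :
    (if arcKind ω.2.firstSideG (ω.z1 hr h) = .corner then
          HV.edir (f.hv ω.2.firstSideG) (f.hv ω.1) * HV.pwt (ω.2.hvWalk ++ [f.hv ω.2.firstSideG])
        else HV.edir (f.hv ω.1) (HV.finalDart ω.2.hvWalk).1 * HV.pwt ω.2.hvWalk) +
      (if arcKind ω.2.firstSideG ω.1 = .corner then
          HV.edir (f.hv ω.2.firstSideG) (f.hv (ω.z1 hr h)) * HV.pwt ((ω.rev hr).2.hvWalk ++ [f.hv ω.2.firstSideG])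
        else HV.edir (f.hv (ω.z1 hr h)) (HV.finalDart (ω.rev hr).2.hvWalk).1 * HV.pwt (ω.rev hr).2.hvWalk) = 0 := by
  rw [← two_mul_omg_sub_one_mul_G_add_G_rev_pi_div_three_eq hD hr h hw, ω.G_add_G_rev_of_unwound _ hr h hU, mul_zero]

end ΩG

end GroupPair

/-! ## §5. The counting form (edition 3): the number of encircling honeycomb terms at a rhombus is the number of
wound returning walks of non-zero weight — the lane's census quantity `C(f)` in Glazman–Manolescu's variables

The bijections behind §2 (`Finset.sum_image` there) as set identities and cardinalities: the side-ending encircling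
loop-class walks at the triangle `f.hv σ` are the honeycomb walks of the wound non-`θ`-corner walks of non-zero weight
returning into it, the diagonal-ending ones are the pushed honeycomb walks of the wound `θ`-corner walks of non-zero weight
whose arc lies in it, each walk counted once. Summed over the two triangles: the census count
`C(f) = #E_{T₁ f} + #E_{T₂ f}` of encircling loop-class walks through the two triangles of `f` (HOME
`FINDING-HEX-NO-CANCELLATION.md`) EQUALS the number of wound class-`B2a` walks at `f` of non-zero `π/3`-weight (every such walk
gives exactly one encircling term — the prediction P11 of `FINDING-HEX-DICTIONARY-THIRD-CLASS.md`, now a theorem), and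
`C(f) = 0` iff every wound returning walk at `f` has `π/3`-weight zero. -/

section Counting

namespace ΩG

open YBWalk HV

open private fh_lt from Literature.Probability.RandomPlanarGeometry.YangBaxterSAWGeneralDomain

variable {Dl : List Face} {f : Face}

open scoped Classical in
/-- **The side-ending encircling walks at `f.hv σ` ARE the honeycomb walks of the wound non-`θ`-corner returning walks of
non-zero weight into `f.hv σ`** (set form of the bijection of §2 / the winding file's editions 1–2).
[cite: DuminilCopinSmirnov2012, proof of Lemma 1 (the walks through all three mid-edges of `v`)] [cite: GlazmanManolescu2019, §1 (Fig. 2), Lemma 2.1]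
[cite: Glazman2015WeightedSAW, Lemma 3.1 (proof, pp. 6–7)] -/
theorem filter_encircling_side_eq_image (hD : ((-1 : ℤ), (0 : ℤ)) ∉ Dl) (f : Face) (σ : Side) :
    ((clsLoop (triSet Dl.toFinset) (f.hv σ)).filter (fun P => HV.loopWnd (f.hv σ) P ≠ 0)).filter
        (fun P => (edgeOf (HV.finalDart P).1 (HV.finalDart P).2).isSome) =
      ((Finset.univ : Finset (ΩG (PlaquetteWalk.dom Dl) origin f)).filter (fun ω =>
        (ω.1).tri = σ.tri ∧ ω.2.weight (fun _ => π / 3) ≠ 0 ∧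
        ∃ (hr : RootedFace (PlaquetteWalk.dom Dl) origin f) (h : ω.IsB2a),
          arcKind ω.2.firstSideG (ω.z1 hr h) ≠ .corner ∧ ω.AJ hr h (toC (midPt origin)) ≠ 0)).image
        (fun ω => ω.2.hvWalk) := by
  have hD' : ((-1 : ℤ), (0 : ℤ)) ∉ PlaquetteWalk.dom Dl := hD
  ext P
  simp only [Finset.mem_filter, Finset.mem_image, Finset.mem_univ, true_and]
  constructor
  · rintro ⟨⟨hP, hwnd⟩, hE⟩
    obtain ⟨ω, hr, h, hωP, htri, hw, hκ, hiff⟩ := exists_isB2a_of_mem_clsLoop (f := f) hD hP hE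
    exact ⟨ω, ⟨htri, hw, hr, h, hκ, hiff.1 hwnd⟩, hωP⟩
  · rintro ⟨ω, ⟨htri, hw, hr, h, hκ, hAJ⟩, rfl⟩
    have hT : f.hv ω.1 = f.hv σ := Face.hv_eq_hv_iff.2 ⟨rfl, htri⟩
    have hm := (hvWalk_mem_encircling_iff_AJ_root_ne_zero (hr := hr) hD h hκ hw).2 hAJ
    rw [Finset.mem_filter, hT] at hm
    refine ⟨hm, ?_⟩
    rw [ω.2.edgeOf_finalDart_hvWalk_of_origin' hD']
    rfl

open scoped Classical in
/-- **The diagonal-ending encircling walks at `f.hv σ` ARE the pushed honeycomb walks of the wound `θ`-corner returning walks of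
non-zero weight whose arc lies in `f.hv σ`** (set form of the bijection of §2 / the winding file's edition 6).
[cite: DuminilCopinSmirnov2012, proof of Lemma 1 (the walks through all three mid-edges of `v`)] [cite: GlazmanManolescu2019, §1 (Fig. 2), Lemma 2.1]
[cite: Glazman2015WeightedSAW, Lemma 3.1 (proof, pp. 6–7)] -/
theorem filter_encircling_diag_eq_image (hD : ((-1 : ℤ), (0 : ℤ)) ∉ Dl) (f : Face) (σ : Side) :
    ((clsLoop (triSet Dl.toFinset) (f.hv σ)).filter (fun P => HV.loopWnd (f.hv σ) P ≠ 0)).filter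
        (fun P => ¬ ((edgeOf (HV.finalDart P).1 (HV.finalDart P).2).isSome)) =
      ((Finset.univ : Finset (ΩG (PlaquetteWalk.dom Dl) origin f)).filter (fun ω =>
        f.hv ω.2.firstSideG = f.hv σ ∧ ω.2.weight (fun _ => π / 3) ≠ 0 ∧
        ∃ (hr : RootedFace (PlaquetteWalk.dom Dl) origin f) (h : ω.IsB2a),
          arcKind ω.2.firstSideG (ω.z1 hr h) = .corner ∧ ω.AJ hr h (toC (midPt origin)) ≠ 0)).image
        (fun ω => ω.2.hvWalk ++ [f.hv σ]) := by
  have hD' : ((-1 : ℤ), (0 : ℤ)) ∉ PlaquetteWalk.dom Dl := hD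
  ext P
  simp only [Finset.mem_filter, Finset.mem_image, Finset.mem_univ, true_and]
  constructor
  · rintro ⟨⟨hP, hwnd⟩, hE⟩
    obtain ⟨σ', hσ', hfst⟩ := exists_finalDart_fst_eq_hv_of_not_isSome (f := f) hP hE
    obtain ⟨ω, hr, h, hωP, -, hw, hc, hT, hiff⟩ := exists_isB2a_corner_of_mem_clsLoop_diag hD hσ' hP hfst
    exact ⟨ω, ⟨hT, hw, hr, h, hc, hiff.1 hwnd⟩, hωP⟩
  · rintro ⟨ω, ⟨hT, hw, hr, h, hc, hAJ⟩, rfl⟩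
    obtain ⟨-, hmem, hiff⟩ := hvWalk_append_mem_clsLoop_of_corner (hr := hr) hD h hc hw
    rw [hT] at hmem hiff
    refine ⟨⟨hmem, hiff.2 hAJ⟩, ?_⟩
    have hpos : 0 < ω.2.arcs.length := by have := fh_lt ω h; omega
    rw [finalDart_hvWalk_append hD' ω.2 hpos (fc_ne_of_isB2a hr h) _, edgeOf_hv_hv]
    exact Bool.false_ne_true

open scoped Classical in
/-- ★ **THE COUNT AT ONE TRIANGLE**: the number of encircling loop-class walks at `f.hv σ` (the census quantity `#E_{f.hv σ}`) is
the number of wound non-`θ`-corner returning walks of non-zero weight into `f.hv σ` plus the number of wound `θ`-corner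
returning walks of non-zero weight whose arc lies in `f.hv σ` (injectivity: `eq_of_hvWalk_eq_of_origin`).
[cite: DuminilCopinSmirnov2012, proof of Lemma 1 (the encircling pairs)] [cite: GlazmanManolescu2019, §1 (Fig. 2), Lemma 2.1]
[cite: Glazman2015WeightedSAW, Lemma 3.1 (proof, pp. 6–7)] -/
theorem card_encircling_hv_eq (hD : ((-1 : ℤ), (0 : ℤ)) ∉ Dl) (f : Face) (σ : Side) :
    ((clsLoop (triSet Dl.toFinset) (f.hv σ)).filter (fun P => HV.loopWnd (f.hv σ) P ≠ 0)).card =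
      ((Finset.univ : Finset (ΩG (PlaquetteWalk.dom Dl) origin f)).filter (fun ω =>
        (ω.1).tri = σ.tri ∧ ω.2.weight (fun _ => π / 3) ≠ 0 ∧
        ∃ (hr : RootedFace (PlaquetteWalk.dom Dl) origin f) (h : ω.IsB2a),
          arcKind ω.2.firstSideG (ω.z1 hr h) ≠ .corner ∧ ω.AJ hr h (toC (midPt origin)) ≠ 0)).card +
      ((Finset.univ : Finset (ΩG (PlaquetteWalk.dom Dl) origin f)).filter (fun ω =>
        f.hv ω.2.firstSideG = f.hv σ ∧ ω.2.weight (fun _ => π / 3) ≠ 0 ∧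
        ∃ (hr : RootedFace (PlaquetteWalk.dom Dl) origin f) (h : ω.IsB2a),
          arcKind ω.2.firstSideG (ω.z1 hr h) = .corner ∧ ω.AJ hr h (toC (midPt origin)) ≠ 0)).card := by
  have hD' : ((-1 : ℤ), (0 : ℤ)) ∉ PlaquetteWalk.dom Dl := hD
  rw [← Finset.card_filter_add_card_filter_not (fun P => ((edgeOf (HV.finalDart P).1 (HV.finalDart P).2).isSome)),
    filter_encircling_side_eq_image hD f σ, filter_encircling_diag_eq_image hD f σ,
    Finset.card_image_of_injOn, Finset.card_image_of_injOn]
  · intro ω hω ω' hω' e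
    simp only [Finset.coe_filter, Finset.mem_univ, true_and, Set.mem_setOf_eq] at hω hω'
    obtain ⟨-, -, hr, h, -⟩ := hω
    obtain ⟨-, -, hr', h', -⟩ := hω'
    have h1 := fh_lt ω h
    have h2 := fh_lt ω' h'
    exact eq_of_hvWalk_eq_of_origin hD' (by omega) (by omega) (List.append_cancel_right e)
  · intro ω hω ω' hω' e
    simp only [Finset.coe_filter, Finset.mem_univ, true_and, Set.mem_setOf_eq] at hω hω'
    obtain ⟨-, -, hr, h, -⟩ := hω
    obtain ⟨-, -, hr', h', -⟩ := hω'
    have h1 := fh_lt ω h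
    have h2 := fh_lt ω' h'
    exact eq_of_hvWalk_eq_of_origin hD' (by omega) (by omega) e

open scoped Classical in
/-- ★★ **`C(f)` = THE NUMBER OF WOUND RETURNING WALKS OF NON-ZERO WEIGHT.** For every finite rhombus list `Dl` not containing
`(−1, 0)`, rooted at the origin, and every rhombus `f`: the number of encircling loop-class walks of Duminil-Copin–Smirnov at the
triangle `f.hv W` plus the number at `f.hv E` — the lane's census count `C(f)` of the encircling honeycomb terms carrying the
hole-root defect at `π/3` — equals the number of Glazman–Manolescu walks `ω` from the origin of class `B2a` at `f` that are WOUND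
(`AJ ≠ 0`) and of non-zero `π/3`-weight: every such walk gives exactly one encircling term (side-ending at its return triangle for
a non-`θ`-corner arc, diagonal-ending at its arc's triangle for a `θ`-corner arc), the four classes are disjoint, and nothing else
encircles. [cite: DuminilCopinSmirnov2012, Lemma 1 and its proof (the encircling pairs)] [cite: GlazmanManolescu2019, §1 (θ = π/3, Fig. 2), Lemma 2.1]
[cite: Glazman2015WeightedSAW, Lemma 3.1 (proof, pp. 6–7)] -/
theorem card_encircling_add_card_encircling_eq_card_wound (hD : ((-1 : ℤ), (0 : ℤ)) ∉ Dl) (f : Face) :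
    ((clsLoop (triSet Dl.toFinset) (f.hv .W)).filter (fun P => HV.loopWnd (f.hv .W) P ≠ 0)).card +
      ((clsLoop (triSet Dl.toFinset) (f.hv .E)).filter (fun P => HV.loopWnd (f.hv .E) P ≠ 0)).card =
      ((Finset.univ : Finset (ΩG (PlaquetteWalk.dom Dl) origin f)).filter (fun ω =>
        ω.2.weight (fun _ => π / 3) ≠ 0 ∧
        ∃ (hr : RootedFace (PlaquetteWalk.dom Dl) origin f) (h : ω.IsB2a), ω.AJ hr h (toC (midPt origin)) ≠ 0)).card := by
  rw [card_encircling_hv_eq hD f .W, card_encircling_hv_eq hD f .E]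
  -- the four index sets
  set SW := (Finset.univ : Finset (ΩG (PlaquetteWalk.dom Dl) origin f)).filter (fun ω =>
        (ω.1).tri = Side.W.tri ∧ ω.2.weight (fun _ => π / 3) ≠ 0 ∧
        ∃ (hr : RootedFace (PlaquetteWalk.dom Dl) origin f) (h : ω.IsB2a),
          arcKind ω.2.firstSideG (ω.z1 hr h) ≠ .corner ∧ ω.AJ hr h (toC (midPt origin)) ≠ 0) with hSW
  set DW := (Finset.univ : Finset (ΩG (PlaquetteWalk.dom Dl) origin f)).filter (fun ω =>
        f.hv ω.2.firstSideG = f.hv .W ∧ ω.2.weight (fun _ => π / 3) ≠ 0 ∧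
        ∃ (hr : RootedFace (PlaquetteWalk.dom Dl) origin f) (h : ω.IsB2a),
          arcKind ω.2.firstSideG (ω.z1 hr h) = .corner ∧ ω.AJ hr h (toC (midPt origin)) ≠ 0) with hDW
  set SE := (Finset.univ : Finset (ΩG (PlaquetteWalk.dom Dl) origin f)).filter (fun ω =>
        (ω.1).tri = Side.E.tri ∧ ω.2.weight (fun _ => π / 3) ≠ 0 ∧
        ∃ (hr : RootedFace (PlaquetteWalk.dom Dl) origin f) (h : ω.IsB2a),
          arcKind ω.2.firstSideG (ω.z1 hr h) ≠ .corner ∧ ω.AJ hr h (toC (midPt origin)) ≠ 0) with hSE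
  set DE := (Finset.univ : Finset (ΩG (PlaquetteWalk.dom Dl) origin f)).filter (fun ω =>
        f.hv ω.2.firstSideG = f.hv .E ∧ ω.2.weight (fun _ => π / 3) ≠ 0 ∧
        ∃ (hr : RootedFace (PlaquetteWalk.dom Dl) origin f) (h : ω.IsB2a),
          arcKind ω.2.firstSideG (ω.z1 hr h) = .corner ∧ ω.AJ hr h (toC (midPt origin)) ≠ 0) with hDE
  set T := (Finset.univ : Finset (ΩG (PlaquetteWalk.dom Dl) origin f)).filter (fun ω =>
        ω.2.weight (fun _ => π / 3) ≠ 0 ∧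
        ∃ (hr : RootedFace (PlaquetteWalk.dom Dl) origin f) (h : ω.IsB2a), ω.AJ hr h (toC (midPt origin)) ≠ 0) with hT
  have hWE : Face.hv f .W ≠ f.hv .E := fun e => by have := (Face.hv_eq_hv_iff.1 e).2; exact absurd this (by decide)
  -- pairwise disjointness
  have d1 : Disjoint SW DW := by
    rw [hSW, hDW, Finset.disjoint_filter]
    rintro ω - ⟨-, -, hr, h, hκ, -⟩ ⟨-, -, hr', h', hc, -⟩
    exact hκ hc
  have d2 : Disjoint SE DE := by
    rw [hSE, hDE, Finset.disjoint_filter]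
    rintro ω - ⟨-, -, hr, h, hκ, -⟩ ⟨-, -, hr', h', hc, -⟩
    exact hκ hc
  have d3 : Disjoint (SW ∪ DW) (SE ∪ DE) := by
    rw [Finset.disjoint_union_left, Finset.disjoint_union_right, Finset.disjoint_union_right, hSW, hDW, hSE, hDE]
    refine ⟨⟨?_, ?_⟩, ?_, ?_⟩ <;> rw [Finset.disjoint_filter]
    · rintro ω - ⟨ht, -⟩ ⟨ht', -⟩
      rw [ht] at ht'; exact absurd ht' (by decide)
    · rintro ω - ⟨-, -, hr, h, hκ, -⟩ ⟨-, -, hr', h', hc, -⟩; exact hκ hc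
    · rintro ω - ⟨-, -, hr, h, hc, -⟩ ⟨-, -, hr', h', hκ, -⟩; exact hκ hc
    · rintro ω - ⟨ht, -⟩ ⟨ht', -⟩
      exact hWE (ht.symm.trans ht')
  rw [← Finset.card_union_of_disjoint d1, ← Finset.card_union_of_disjoint d2, ← Finset.card_union_of_disjoint d3]
  congr 1
  ext ω
  simp only [Finset.mem_union, hSW, hDW, hSE, hDE, hT, Finset.mem_filter, Finset.mem_univ, true_and]
  constructor
  · rintro ((⟨-, hw, hr, h, -, hA⟩ | ⟨-, hw, hr, h, -, hA⟩) | (⟨-, hw, hr, h, -, hA⟩ | ⟨-, hw, hr, h, -, hA⟩)) <;>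
      exact ⟨hw, hr, h, hA⟩
  · rintro ⟨hw, hr, h, hA⟩
    by_cases hc : arcKind ω.2.firstSideG (ω.z1 hr h) = .corner
    · -- a `θ`-corner arc: classified by the triangle of the first side
      cases hz : ω.2.firstSideG.tri
      · exact Or.inl (Or.inr ⟨Face.hv_eq_hv_iff.2 ⟨rfl, hz⟩, hw, hr, h, hc, hA⟩)
      · exact Or.inr (Or.inr ⟨Face.hv_eq_hv_iff.2 ⟨rfl, hz⟩, hw, hr, h, hc, hA⟩)
    · -- a non-`θ`-corner arc: classified by the return triangle
      cases hz : (ω.1).tri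
      · exact Or.inl (Or.inl ⟨rfl, hw, hr, h, hc, hA⟩)
      · exact Or.inr (Or.inl ⟨rfl, hw, hr, h, hc, hA⟩)

open scoped Classical in
/-- ★ **`C(f) = 0` iff every wound returning walk at `f` has zero `π/3`-weight** — the combinatorial content of the lane's
`C(f) = 0` test (HOME `FINDING-HEX-NO-CANCELLATION.md`: `C(f) = 0 ⇒ VF_{π/3}(f) = 0`, the converse being the conjecture
C-HEX-NC): no encircling loop-class walk passes the two triangles of `f` exactly when the wound class-`B2a` walks at `f` all carry a
rhombus with two `(π−θ)`-corner arcs (`w₂(π/3) = 0`, the dictionary's weight criterion). [cite: DuminilCopinSmirnov2012, Lemma 1 and its proof]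
[cite: GlazmanManolescu2019, §1 (θ = π/3: «w₂ = 0»), Lemma 2.1] [cite: Glazman2015WeightedSAW, Lemma 3.1 (proof, pp. 6–7)] -/
theorem encircling_eq_empty_iff_forall_wound_weight_eq_zero (hD : ((-1 : ℤ), (0 : ℤ)) ∉ Dl) (f : Face) :
    ((clsLoop (triSet Dl.toFinset) (f.hv .W)).filter (fun P => HV.loopWnd (f.hv .W) P ≠ 0) = ∅ ∧
      (clsLoop (triSet Dl.toFinset) (f.hv .E)).filter (fun P => HV.loopWnd (f.hv .E) P ≠ 0) = ∅) ↔
      ∀ (ω : ΩG (PlaquetteWalk.dom Dl) origin f) (hr : RootedFace (PlaquetteWalk.dom Dl) origin f) (h : ω.IsB2a),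
        ω.AJ hr h (toC (midPt origin)) ≠ 0 → ω.2.weight (fun _ => π / 3) = 0 := by
  have hc := card_encircling_add_card_encircling_eq_card_wound hD f
  rw [← Finset.card_eq_zero, ← Finset.card_eq_zero, ← Nat.add_eq_zero_iff, hc, Finset.card_eq_zero,
    Finset.filter_eq_empty_iff]
  constructor
  · intro H ω hr h hA
    by_contra hw
    exact H (Finset.mem_univ ω) ⟨hw, hr, h, hA⟩
  · rintro H ω - ⟨hw, hr, h, hA⟩
    exact hw (H ω hr h hA)

end ΩG

end Counting


/-! ## §6. Group one = two triplets (edition 4): Glazman–Manolescu's first group of a class-`A` walk is, at `θ = π/3`, the sum of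
Duminil-Copin–Smirnov's triplets at the two triangles -/

section GroupOne

namespace ΩG

open YBWalk HV

open private IsA extA_fst extA_snd_arcs paraWeight_extA arcFace_ne_of_isA
  from Literature.Probability.RandomPlanarGeometry.YangBaxterSAWGeneralDomain

variable {D : Set Face} {f : Face} {ω : ΩG D origin f}

/-- **The honeycomb walk of a one-arc extension.** For a class-`A` walk `ω` at `f` from the origin (its first hit of `∂f` is its
end, at the side `ω.1`) and a side `z' ≠ ω.1`, the honeycomb walk of Glazman–Manolescu's extension `extA ω z'` (the arc `ω.1 → z'`
appended) is that of `ω` followed by the triangle of `z'` when the arc crosses the diagonal, and by the triangle across `z'`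
(the dictionary's `hvWalk_of_arcs_snoc_origin`). [cite: GlazmanManolescu2019, §1 (Fig. 2), Lemma 2.1 (proof: the classes of walks at a rhombus)]
[cite: Glazman2015WeightedSAW, Lemma 3.1 (proof, pp. 6–7)] -/
theorem hvWalk_extA (hD : ((-1 : ℤ), (0 : ℤ)) ∉ D) (hr : RootedFace D origin f) (hA : ω.2.firstHitG = ω.2.arcs.length) {z' : Side}
    (hz : z' ≠ ω.1) :
    (ω.extA hr z').2.hvWalk = ω.2.hvWalk ++ ((if (ω.1).tri = z'.tri then [] else [f.hv z']) ++ [f.hvAcross z']) := by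
  have harcs := extA_snd_arcs ω hr hA hz
  have hfst := extA_fst ω hr hA hz
  have hst : ω.1 ≠ (ω.extA hr z').1 := by rw [hfst]; exact hz.symm
  have harcs' : (ω.extA hr z').2.arcs = ω.2.arcs ++ [(f.side ω.1, f.side (ω.extA hr z').1)] := by
    rw [harcs]; congr 3; rw [hfst]
  have key := hvWalk_of_arcs_snoc_origin hD harcs' hr.mem hst rfl rfl (fun hn e =>
    arcFace_ne_of_isA ω hA (i := ω.2.arcs.length - 1) (by omega) (by rw [ω.2.arcFace_nth_eq_fc (by omega), e]))
  rw [key]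
  congr 2
  · rw [hfst]
  · rw [hfst]

/-- A walk of non-zero weight has non-zero parafermionic weight. [cite: GlazmanManolescu2019, eq. (2.1)] -/
theorem _root_.Literature.Probability.RandomPlanarGeometry.SAW.YangBaxter.YBWalk.paraWeight_ne_zero_of_weight_ne_zero
    {D : Set Face} {a z : MidEdge} (γ : YBWalk D a z) {Θ : ℤ → ℝ} (hw : γ.weight Θ ≠ 0) : γ.paraWeight Θ ≠ 0 := by
  rw [YBWalk.paraWeight]
  exact mul_ne_zero (by exact_mod_cast hw) (Complex.exp_ne_zero _)

/-- **The one-arc extensions keep the `π/3`-weight non-zero** (the new arc weighs `x_c` or `x_c²`; `paraWeight_extA`).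
[cite: GlazmanManolescu2019, §1 («v = w₁ = u₂ = u₁²»)] [cite: Glazman2015WeightedSAW, Lemma 3.1 (proof, pp. 6–7)] -/
theorem weight_extA_pi_div_three_ne_zero (hr : RootedFace D origin f) (hA : ω.2.firstHitG = ω.2.arcs.length) {z' : Side} (hz : z' ≠ ω.1)
    (hw : ω.2.weight (fun _ => π / 3) ≠ 0) : (ω.extA hr z').2.weight (fun _ => π / 3) ≠ 0 := by
  intro h0
  have hp := (ω.extA hr z').2.paraWeight_eq_zero_of_weight_eq_zero h0
  rw [paraWeight_extA ω (fun _ => π / 3) hr hA hz] at hp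
  have h1 : ω.2.paraWeight (fun _ => π / 3) ≠ 0 := ω.2.paraWeight_ne_zero_of_weight_ne_zero hw
  have h2 : (arcWeight (π / 3) ω.1 z' : ℂ) ≠ 0 := by
    rw [arcWeight]; exact_mod_cast localWeight_pi_div_three_single_ne_zero (arcKind_ne_degen hz.symm)
  have h3 : phase (arcTurn (π / 3) ω.1 z') ≠ 0 := by unfold phase; exact Complex.exp_ne_zero _
  exact mul_ne_zero (mul_ne_zero h1 h2) h3 hp

/-- ★ **THE TERM OF AN EXTENSION IS DUMINIL-COPIN–SMIRNOV'S TERM OF ITS HONEYCOMB WALK**: `(2ω − 1)·g(extA ω z')` equals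
`edir (f.hv z') (f.hvAcross z') · pwt (hvWalk (extA ω z'))` — the contribution, at the triangle of `z'`, of the honeycomb walk LEAVING that
triangle across `z'` (the second summand of the lane's `HV.cv`). [cite: DuminilCopinSmirnov2012, proof of Lemma 1 («c(γ)»; the triplets)]
[cite: GlazmanManolescu2019, Lemma 2.1, eq. (CR)] -/
theorem two_mul_omg_sub_one_mul_g_extA_pi_div_three (hr : RootedFace D origin f)
    (hA : ω.2.firstHitG = ω.2.arcs.length) {z' : Side} (hz : z' ≠ ω.1) (hw : ω.2.weight (fun _ => π / 3) ≠ 0) :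
    (2 * HV.omg - 1) * (ω.extA hr z').g (fun _ => π / 3) =
      HV.edir (f.hv z') (f.hvAcross z') * HV.pwt (ω.extA hr z').2.hvWalk := by
  have hw' := weight_extA_pi_div_three_ne_zero hr hA hz hw
  have hfst := extA_fst ω hr hA hz
  have hc : crCoef (π / 3) (ω.extA hr z').1 = crCoef (π / 3) z' := by rw [hfst]
  have hg : (ω.extA hr z').g (fun _ => π / 3) = crCoef (π / 3) (ω.extA hr z').1 * (ω.extA hr z').2.paraWeight (fun _ => π / 3) := rfl
  rw [hg, hc, (ω.extA hr z').2.paraWeight_pi_div_three hw', edir_hv_hvAcross, mul_assoc]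

/-- **The term of a walk to `∂f` in Duminil-Copin–Smirnov's form**: `(2ω − 1)·g(ω) = edir (f.hv ω.1) (f.hvAcross ω.1) · pwt (hvWalk ω)` for
every walk of non-zero `π/3`-weight (the dictionary's weight identity and `edir_hv_hvAcross`; for a walk arriving from outside `f` the dart
`(f.hvAcross ω.1, f.hv ω.1)` is its final dart, `YBWalk.edir_mul_pwt_hvWalk_eq`). [cite: DuminilCopinSmirnov2012, proof of Lemma 1 («c(γ)»)]
[cite: GlazmanManolescu2019, Lemma 2.1, eq. (CR)] -/
theorem two_mul_omg_sub_one_mul_g_pi_div_three (ω : ΩG D origin f) (hw : ω.2.weight (fun _ => π / 3) ≠ 0) :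
    (2 * HV.omg - 1) * ω.g (fun _ => π / 3) = HV.edir (f.hv ω.1) (f.hvAcross ω.1) * HV.pwt ω.2.hvWalk := by
  have hg : ω.g (fun _ => π / 3) = crCoef (π / 3) ω.1 * ω.2.paraWeight (fun _ => π / 3) := rfl
  rw [hg, ω.2.paraWeight_pi_div_three hw, edir_hv_hvAcross, mul_assoc]

/-- The opposite side lies on the other triangle. [cite: GlazmanManolescu2019, §1 (Fig. 2)] -/
theorem _root_.Literature.Probability.RandomPlanarGeometry.SAW.YangBaxter.Side.tri_opp_ne (s : Side) : s.opp.tri ≠ s.tri := by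
  cases s <;> decide

/-- ★★ **GROUP ONE = TWO TRIPLETS.** For a class-`A` walk `ω` at `f` from the origin (first hit of `∂f` = its end, side `z = ω.1`;
triangle `T = f.hv z`, other triangle `T' = f.hv z.opp`) of non-zero `π/3`-weight: `2ω − 1` times Glazman–Manolescu's FIRST group
`g(ω) + Σ_{z' ≠ z} g(extA ω z')` (the walk and its three one-arc extensions — the group of the first local relation) EQUALS the sum of
Duminil-Copin–Smirnov's TRIPLET at `T` for `P = hvWalk ω` — `P` (arriving at `T` across `z`), `P` extended across the other side of `T`
(the `θ`-corner extension), `P` extended along the short diagonal to `T'` — and his TRIPLET at `T'` for `Q = P ++ [T']` — `Q`, and `Q`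
extended across the two sides of `T'` (the two extensions crossing the diagonal) —; the two diagonal terms `edir T T'·pwt Q + edir T' T·pwt Q`
cancel. (Both triplets vanish: `tripletSide_pi_div_three_eq_zero`, `tripletDiag_pi_div_three_eq_zero` — DCS's triplet identity; so does
GM's group — his first local relation `groupOne_gen`; at `π/3` the one IS the sum of the other two. With §4, GROUP = PAIR, the proof-level
dictionary is complete: GM's two local relations at `π/3` are DCS's triplet and pair relations.) [cite: DuminilCopinSmirnov2012, proof of Lemma 1
(«the set of walks … can be partitioned into pairs and triplets»)] [cite: GlazmanManolescu2019, Lemma 2.1 (proof: [Gl], Lemma 3.1, the first relation)]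
[cite: Glazman2015WeightedSAW, Lemma 3.1 (proof, pp. 6–7)] -/
theorem two_mul_omg_sub_one_mul_groupOne_pi_div_three_eq (hD : ((-1 : ℤ), (0 : ℤ)) ∉ D) (hr : RootedFace D origin f)
    (hA : ω.2.firstHitG = ω.2.arcs.length) (hw : ω.2.weight (fun _ => π / 3) ≠ 0) :
    (2 * HV.omg - 1) * (ω.g (fun _ => π / 3) + ∑ z' ∈ Finset.univ.erase ω.1, (ω.extA hr z').g (fun _ => π / 3)) =
      (HV.edir (f.hv ω.1) (f.hvAcross ω.1) * HV.pwt ω.2.hvWalk +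
        ∑ z' ∈ (Finset.univ.erase ω.1).filter (fun z' => (ω.1).tri = z'.tri),
          HV.edir (f.hv ω.1) (f.hvAcross z') * HV.pwt (ω.2.hvWalk ++ [f.hvAcross z']) +
        HV.edir (f.hv ω.1) (f.hv (ω.1).opp) * HV.pwt (ω.2.hvWalk ++ [f.hv (ω.1).opp])) +
      (HV.edir (f.hv (ω.1).opp) (f.hv ω.1) * HV.pwt (ω.2.hvWalk ++ [f.hv (ω.1).opp]) +
        ∑ z' ∈ (Finset.univ.erase ω.1).filter (fun z' => ¬ (ω.1).tri = z'.tri),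
          HV.edir (f.hv (ω.1).opp) (f.hvAcross z') * HV.pwt (ω.2.hvWalk ++ [f.hv (ω.1).opp, f.hvAcross z'])) := by
  -- the diagonal darts cancel
  have hdiag : HV.edir (f.hv ω.1) (f.hv (ω.1).opp) * HV.pwt (ω.2.hvWalk ++ [f.hv (ω.1).opp]) +
      HV.edir (f.hv (ω.1).opp) (f.hv ω.1) * HV.pwt (ω.2.hvWalk ++ [f.hv (ω.1).opp]) = 0 := by
    rw [HV.edir_rev (f.hv ω.1) (f.hv (ω.1).opp)]; ring
  -- split GM's sum by the triangle of the new side and rewrite each extension's term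
  rw [← Finset.sum_filter_add_sum_filter_not (Finset.univ.erase ω.1) (fun z' => (ω.1).tri = z'.tri)]
  have hsame : ∀ z' ∈ (Finset.univ.erase ω.1).filter (fun z' => (ω.1).tri = z'.tri),
      (2 * HV.omg - 1) * (ω.extA hr z').g (fun _ => π / 3) =
        HV.edir (f.hv ω.1) (f.hvAcross z') * HV.pwt (ω.2.hvWalk ++ [f.hvAcross z']) := by
    intro z' hz'
    rw [Finset.mem_filter, Finset.mem_erase] at hz'
    obtain ⟨⟨hz, -⟩, ht⟩ := hz'
    rw [two_mul_omg_sub_one_mul_g_extA_pi_div_three hr hA hz hw, hvWalk_extA hD hr hA hz, if_pos ht,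
      List.nil_append, Face.hv_eq_hv_iff.2 ⟨rfl, ht.symm⟩]
  have hother : ∀ z' ∈ (Finset.univ.erase ω.1).filter (fun z' => ¬ (ω.1).tri = z'.tri),
      (2 * HV.omg - 1) * (ω.extA hr z').g (fun _ => π / 3) =
        HV.edir (f.hv (ω.1).opp) (f.hvAcross z') * HV.pwt (ω.2.hvWalk ++ [f.hv (ω.1).opp, f.hvAcross z']) := by
    intro z' hz'
    rw [Finset.mem_filter, Finset.mem_erase] at hz'
    obtain ⟨⟨hz, -⟩, ht⟩ := hz'
    have htri : z'.tri = (ω.1).opp.tri := by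
      have := Side.tri_opp_ne ω.1
      revert ht this; cases z'.tri <;> cases (ω.1).tri <;> cases (ω.1).opp.tri <;> simp
    rw [two_mul_omg_sub_one_mul_g_extA_pi_div_three hr hA hz hw, hvWalk_extA hD hr hA hz, if_neg ht,
      Face.hv_eq_hv_iff.2 ⟨rfl, htri⟩]
    simp
  rw [mul_add, mul_add, Finset.mul_sum, Finset.mul_sum, Finset.sum_congr rfl hsame, Finset.sum_congr rfl hother,
    two_mul_omg_sub_one_mul_g_pi_div_three ω hw]
  linear_combination -hdiag

/-- Duminil-Copin–Smirnov's weight after appending two vertices: one more visited vertex (`x_c`) and the turn into the last dart.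
[cite: DuminilCopinSmirnov2012, §2 (the weight `x^{ℓ} e^{-iσ W}`)] -/
theorem _root_.Literature.Probability.RandomPlanarGeometry.SAW.HV.pwt_append_pair (L : List HV) (hL : L ≠ []) (v x : HV) :
    HV.pwt (L ++ [v, x]) = HV.pwt (L ++ [v]) * (hexCriticalFugacity : ℂ) * HV.lam ^ HV.turn (L.getLast hL) v x := by
  have hm : HV.mwLen (L ++ [v, x]) = HV.mwLen (L ++ [v]) + 1 := by
    simp only [HV.mwLen, List.length_append, List.length_cons, List.length_nil]
    have : 0 < L.length := List.length_pos_of_ne_nil hL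
    omega
  rw [HV.pwt, HV.pwt, HV.pturn_concat_turn L hL v x, hm, pow_succ, zpow_add₀ HV.lam_ne_zero]
  ring

/-- **The triplet identity at the far triangle, in the rhombus frame**: for every side `s` (triangle `T = f.hv s`, far triangle
`T' = f.hv s.opp`), the constants of DCS's triplet at `T'` for a walk entering `T'` along the diagonal from `T` sum to zero:
`edir T' T + x_c · Σ_{z' on T'} λ^{turn} · edir T' (hvAcross z') = 0` — `1 + x_c(ω²λ⁻¹ − ωλ) = 0` rotated (`HV.triplet_identity`).
[cite: DuminilCopinSmirnov2012, proof of Lemma 1 (the triplet identity, «the only place where we use x = x_c»)] -/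
theorem tripletConst_pi_div_three_diag (s : Side) :
    (if s.opp.tri then -1 else 1) * (1 + HV.omg) +
      (hexCriticalFugacity : ℂ) * ∑ z' ∈ (Finset.univ.erase s).filter (fun z' => ¬ s.tri = z'.tri),
        HV.lam ^ (if z' = .W ∨ z' = .E then (1 : ℤ) else -1) * ((2 * HV.omg - 1) * crCoef (π / 3) z') = 0 := by
  have hT := HV.triplet_identity
  rw [zpow_neg, zpow_one] at hT
  have hω := HV.omg_sq
  have hN : crCoef (π / 3) .N = HV.omg := rfl
  have hS : crCoef (π / 3) .S = -HV.omg := rfl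
  have hE : crCoef (π / 3) .E = 1 := rfl
  have hW : crCoef (π / 3) .W = -1 := rfl
  cases s
  · rw [show (Finset.univ.erase Side.W).filter (fun z' => ¬ Side.W.tri = z'.tri) = {Side.E, Side.S} by decide,
      Finset.sum_pair (by decide)]
    simp only [Side.opp, Side.tri, hE, hS, if_true, if_false, reduceCtorEq, or_true, or_self, zpow_one,
      zpow_neg]
    linear_combination (-(1 + HV.omg)) * hT + ((hexCriticalFugacity : ℂ) * (HV.omg * HV.lam⁻¹ - HV.lam)) * hω
  · rw [show (Finset.univ.erase Side.E).filter (fun z' => ¬ Side.E.tri = z'.tri) = {Side.W, Side.N} by decide,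
      Finset.sum_pair (by decide)]
    simp only [Side.opp, Side.tri, hW, hN, if_true, if_false, reduceCtorEq, or_false, or_self, zpow_one,
      zpow_neg, Bool.false_eq_true]
    linear_combination (1 + HV.omg) * hT + (-(hexCriticalFugacity : ℂ) * (HV.omg * HV.lam⁻¹ - HV.lam)) * hω
  · rw [show (Finset.univ.erase Side.S).filter (fun z' => ¬ Side.S.tri = z'.tri) = {Side.W, Side.N} by decide,
      Finset.sum_pair (by decide)]
    simp only [Side.opp, Side.tri, hW, hN, if_true, if_false, reduceCtorEq, or_false, or_self, zpow_one,
      zpow_neg, Bool.false_eq_true]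
    linear_combination (1 + HV.omg) * hT + (-(hexCriticalFugacity : ℂ) * (HV.omg * HV.lam⁻¹ - HV.lam)) * hω
  · rw [show (Finset.univ.erase Side.N).filter (fun z' => ¬ Side.N.tri = z'.tri) = {Side.E, Side.S} by decide,
      Finset.sum_pair (by decide)]
    simp only [Side.opp, Side.tri, hE, hS, if_true, if_false, reduceCtorEq, or_true, or_self, zpow_one,
      zpow_neg]
    linear_combination (-(1 + HV.omg)) * hT + ((hexCriticalFugacity : ℂ) * (HV.omg * HV.lam⁻¹ - HV.lam)) * hω

/-- The turn into a side from the other triangle (the signed-winding file's table, repeated privately here to avoid an import).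
[cite: DuminilCopinSmirnov2012, §2 (winding by ±π/3 per vertex)] -/
private theorem turn_hv_hv_hvAcross' (f : Face) {s σ : Side} (h : σ.tri ≠ s.tri) :
    HV.turn (f.hv σ) (f.hv s) (f.hvAcross s) = if s = .W ∨ s = .E then 1 else -1 := by
  rw [HV.turn_rev, turn_hvAcross_hv_hv f h]
  split_ifs <;> simp

/-- **Glazman–Manolescu's first local relation, walk by walk, at `π/3`**: for a class-`A` walk the first group sums to zero
(`groupOne_gen` times the parafermionic weight of `ω`; the per-walk form of the tree's `sum_A_add_sum_B1`).
[cite: GlazmanManolescu2019, Lemma 2.1 (proof: [Gl], Lemma 3.1)] [cite: Glazman2015WeightedSAW, Lemma 3.1 (proof, pp. 6–7)] -/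
theorem g_add_sum_g_extA_pi_div_three_eq_zero (hr : RootedFace D origin f) (hA : ω.2.firstHitG = ω.2.arcs.length) :
    ω.g (fun _ => π / 3) + ∑ z' ∈ Finset.univ.erase ω.1, (ω.extA hr z').g (fun _ => π / 3) = 0 := by
  have hθ : weightDen (π / 3) ≠ 0 := by
    rw [weightDen_pi_div_three, neg_ne_zero]
    exact (Real.cos_pos_of_mem_Ioo ⟨by linarith [Real.pi_pos], by linarith [Real.pi_pos]⟩).ne'
  have key := groupOne_gen (π / 3) hθ ω.1
  have e : ∀ z₁ ∈ Finset.univ.erase ω.1, (ω.extA hr z₁).g (fun _ => π / 3) =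
      ω.2.paraWeight (fun _ => π / 3) * (crCoef (π / 3) z₁ * (arcWeight (π / 3) ω.1 z₁ : ℂ) * phase (arcTurn (π / 3) ω.1 z₁)) := by
    intro z₁ hz
    have hz' : z₁ ≠ ω.1 := Finset.ne_of_mem_erase hz
    have hg : (ω.extA hr z₁).g (fun _ => π / 3) =
        crCoef (π / 3) (ω.extA hr z₁).1 * (ω.extA hr z₁).2.paraWeight (fun _ => π / 3) := rfl
    have hc : crCoef (π / 3) (ω.extA hr z₁).1 = crCoef (π / 3) z₁ := by rw [extA_fst ω hr hA hz']
    rw [hg, hc, paraWeight_extA ω (fun _ => π / 3) hr hA hz']; ring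
  have hg0 : ω.g (fun _ => π / 3) = crCoef (π / 3) ω.1 * ω.2.paraWeight (fun _ => π / 3) := rfl
  rw [Finset.sum_congr rfl e, ← Finset.mul_sum, hg0]
  linear_combination ω.2.paraWeight (fun _ => π / 3) * key

/-- ★ **THE FAR TRIPLET VANISHES**: for a nontrivial class-`A` walk at `f`, Duminil-Copin–Smirnov's triplet at the far triangle `T'`
(the walk pushed along the diagonal and its two extensions across the sides of `T'`) sums to zero — by the triplet identity in the
rhombus frame (`tripletConst_pi_div_three_diag`) after factoring `pwt (P ++ [T'])`. [cite: DuminilCopinSmirnov2012, proof of Lemma 1 (the triplets)] -/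
theorem tripletDiag_pi_div_three_eq_zero (hD : ((-1 : ℤ), (0 : ℤ)) ∉ D) (hA : ω.2.firstHitG = ω.2.arcs.length)
    (hn : 0 < ω.2.arcs.length) :
    HV.edir (f.hv (ω.1).opp) (f.hv ω.1) * HV.pwt (ω.2.hvWalk ++ [f.hv (ω.1).opp]) +
      ∑ z' ∈ (Finset.univ.erase ω.1).filter (fun z' => ¬ (ω.1).tri = z'.tri),
        HV.edir (f.hv (ω.1).opp) (f.hvAcross z') * HV.pwt (ω.2.hvWalk ++ [f.hv (ω.1).opp, f.hvAcross z']) = 0 := by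
  have hP0 : ω.2.hvWalk ≠ [] := by rw [ω.2.hvWalk_of_origin hD hn]; exact List.cons_ne_nil _ _
  have hch : ω.2.fc (ω.2.arcs.length - 1) ≠ f := fun e =>
    arcFace_ne_of_isA ω hA (i := ω.2.arcs.length - 1) (by omega) (by rw [ω.2.arcFace_nth_eq_fc (by omega), e])
  have hlast : ω.2.hvWalk.getLast hP0 = f.hv ω.1 := by
    have e := ω.2.hvWalk_of_origin hD hn
    simp only [e, List.getLast_cons (List.append_ne_nil_of_right_ne_nil _ (List.cons_ne_nil _ _)),
      List.getLast_append_of_ne_nil, List.getLast_singleton, ne_eq, List.cons_ne_nil, not_false_eq_true]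
    exact acrossOut_last_eq_hv rfl hn hch
  have hsum : ∀ z' ∈ (Finset.univ.erase ω.1).filter (fun z' => ¬ (ω.1).tri = z'.tri),
      HV.edir (f.hv (ω.1).opp) (f.hvAcross z') * HV.pwt (ω.2.hvWalk ++ [f.hv (ω.1).opp, f.hvAcross z']) =
        HV.pwt (ω.2.hvWalk ++ [f.hv (ω.1).opp]) * (hexCriticalFugacity : ℂ) *
          (HV.lam ^ (if z' = .W ∨ z' = .E then (1 : ℤ) else -1) * ((2 * HV.omg - 1) * crCoef (π / 3) z')) := by
    intro z' hz'
    rw [Finset.mem_filter, Finset.mem_erase] at hz'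
    obtain ⟨⟨hz, -⟩, ht⟩ := hz'
    have htri : (ω.1).opp.tri = z'.tri := by
      have := Side.tri_opp_ne ω.1
      revert ht this; cases z'.tri <;> cases (ω.1).tri <;> cases (ω.1).opp.tri <;> simp
    have hT' : f.hv (ω.1).opp = f.hv z' := Face.hv_eq_hv_iff.2 ⟨rfl, htri⟩
    rw [HV.pwt_append_pair _ hP0, hlast, hT', turn_hv_hv_hvAcross' f ht, edir_hv_hvAcross]
    ring
  rw [Finset.sum_congr rfl hsum, ← Finset.mul_sum, edir_hv_hv_of_tri_ne f (Side.tri_opp_ne ω.1)]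
  have key := tripletConst_pi_div_three_diag ω.1
  linear_combination HV.pwt (ω.2.hvWalk ++ [f.hv (ω.1).opp]) * key

/-- ★ **THE NEAR TRIPLET VANISHES**: for a nontrivial class-`A` walk at `f` of non-zero `π/3`-weight, Duminil-Copin–Smirnov's triplet at
the arrival triangle `T` (the walk, its `θ`-corner extension, the walk pushed along the diagonal) sums to zero — here obtained from GROUP
ONE = TWO TRIPLETS, the far triplet and Glazman–Manolescu's first relation. [cite: DuminilCopinSmirnov2012, proof of Lemma 1 (the triplets)]
[cite: GlazmanManolescu2019, Lemma 2.1] -/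
theorem tripletSide_pi_div_three_eq_zero (hD : ((-1 : ℤ), (0 : ℤ)) ∉ D) (hr : RootedFace D origin f) (hA : ω.2.firstHitG = ω.2.arcs.length)
    (hw : ω.2.weight (fun _ => π / 3) ≠ 0) (hn : 0 < ω.2.arcs.length) :
    HV.edir (f.hv ω.1) (f.hvAcross ω.1) * HV.pwt ω.2.hvWalk +
        ∑ z' ∈ (Finset.univ.erase ω.1).filter (fun z' => (ω.1).tri = z'.tri),
          HV.edir (f.hv ω.1) (f.hvAcross z') * HV.pwt (ω.2.hvWalk ++ [f.hvAcross z']) +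
        HV.edir (f.hv ω.1) (f.hv (ω.1).opp) * HV.pwt (ω.2.hvWalk ++ [f.hv (ω.1).opp]) = 0 := by
  have h5 := two_mul_omg_sub_one_mul_groupOne_pi_div_three_eq hD hr hA hw
  have h6a := tripletDiag_pi_div_three_eq_zero (ω := ω) hD hA hn
  have h6b := g_add_sum_g_extA_pi_div_three_eq_zero hr hA
  linear_combination -h5 + (2 * HV.omg - 1) * h6b - h6a

end ΩG

end GroupOne

end YangBaxter

end Literature.Probability.RandomPlanarGeometry.SAW
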